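import Mathlib.Topology.Order.Lattice
import Mathlib.Analysis.SpecificLimits.Basic
import Mathlib.Topology.Algebra.Order.Archimedean
import Mathlib.Topology.Instances.Rat
import Literature.NumberTheory.ConnesConsani.ArithmeticSiteSquare
import HarnessLib

/-!
# Connes–Consani, *Geometry of the arithmetic site* (2016), §6.3 (end) – §6.4 and Lemma 7.2 at the
# semiring level: the reduced square — `Conv(ℤ × ℤ)` as the reduction of `ℤ_min ⊗_𝔹 ℤ_min`
# (Def. 6.17, Lemma 6.18, Prop. 6.19, Lemma 6.20, Prop. 6.21, Def. 6.22) and the universal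
# property of `γ` for reduced correspondences (Lemma 7.2) — PROVED

Topic `Literature/NumberTheory/ConnesConsani`. Source: A. Connes, C. Consani, *Geometry of the
arithmetic site*, Adv. Math. 291 (2016) 274–329 = arXiv:1502.05580 [bib
`ConnesConsani2016ArithmeticSite`], §6.3 "The Frobenius correspondences on `𝒜`" (Def. 6.17 –
Prop. 6.19), §6.4 "The reduced square" (Lemma 6.20 – Remark 6.23) and §7.1 "Reduced
correspondences" (Lemma 7.2); arXiv pages p0022–p0025. Sequel of `ArithmeticSiteSquare.lean`
(`ℤ_min ⊗_𝔹 ℤ_min = Sub(ℤ × ℤ) = SubZ2` with `quad`, `gen`, `minGens`, `lift`; `μ = mu`,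
`Fr_{n,m} = frobNM`, `ℱ(λ,q) = frobF`, `ℤ_min⁺ ⊗_𝔹 ℤ_min⁺ = subPlus`, `ι₁, ι₂`, Prop. 6.12 (iii),
Prop. 6.13 (i)) and of `FrobeniusComposition.lean` (`ℝ₊^max = 𝕋`, `ℤ_min⁺ = ℕ̄`, `Fr_u = frob`,
Def. 7.1 `ReducedCorrespondence`, the characteristic-one lemmas `add_self_of_one_add_one`,
`eq_zero_of_add_eq_zero_charOne`).

## The statements, verbatim (Adv. Math. numbering)

* §6.3. **Definition 6.17.** "We let `Conv(ℤ × ℤ)` be the set of closed, convex subsets `C ⊂ ℝ²`,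
  `C + ℝ₊² = C`, `∃ z ∈ ℝ², C ⊂ z + ℝ₊²` such that the extreme points `∂C` belong to `ℤ × ℤ`. We
  endow `Conv(ℤ × ℤ)` with the following two operations, the first is the convex hull of the union
  `conv(C ∪ C') = {αx + (1-α)x' ∣ α ∈ [0,1], x ∈ C, x' ∈ C'}` (65) and the second is the sum
  `C + C'`." **Lemma 6.18.** "Endowed with the above two operations `Conv(ℤ × ℤ)` is a semiring of
  characteristic `1`." **Proposition 6.19.** "Let `x, y ∈ ℤ_min ⊗_𝔹 ℤ_min`. One has:
  `ℱ(λ,q)(x) = ℱ(λ,q)(y)` `∀ λ ∈ ℝ₊*` if and only if `μ ∘ Fr_{n,m}(x) = μ ∘ Fr_{n,m}(y)` for all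
  pairs of positive integers `n, m ∈ ℕ`. This defines a congruence relation on the semiring
  `ℤ_min ⊗_𝔹 ℤ_min`. The quotient semiring is the semiring `Conv(ℤ × ℤ)`." (Proof: "For each
  `λ ∈ ℝ₊*` the relation `ℱ(λ,q)(x) = ℱ(λ,q)(y)` is a congruence relation on `ℕ̄ ⊗_𝔹 ℕ̄` independent
  of the choice of `q ∈ (0,1)`. The conjunction of congruences is a congruence […] the convex
  closure of any `E ∈ Sub(ℤ × ℤ)` is obtained as the intersection of the half planes of the form
  `H_{λ,α} := {(x,y) ∈ ℝ² ∣ λx + y ≥ α}`, `λ ∈ ℝ₊*`, `α ≥ 0` which contain `E`.")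
* §6.4. "One has by construction a homomorphism of semirings `γ : ℕ̄ ⊗_𝔹 ℕ̄ → Conv(ℤ × ℤ)` which in
  terms of the description of `ℕ̄ ⊗_𝔹 ℕ̄` as `Sub(ℤ × ℤ)` is simply given by `E ↦ γ(E)`, where `γ(E)`
  is the convex hull of `E`. […] We now show that the homomorphism `γ : ℕ̄ ⊗_𝔹 ℕ̄ → Conv(ℤ × ℤ)` is
  the same as the homomorphism from `ℕ̄ ⊗_𝔹 ℕ̄` to its semiring of quotients […]. We use the notation
  `Ceiling(x) := inf {n ∈ ℤ ∣ n ≥ x}`." **Lemma 6.20.** "Let `a, b ∈ ℕ`, both `≠ 0`. Define an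
  element `σ(a,b) ∈ ℕ̄ ⊗_𝔹 ℕ̄⁺` by `σ(a,b) = ∑_{0 ≤ j ≤ a} q^{a-j} ⊗_𝔹 q^{Ceiling(bj/a)}`. One has
  `ℱ(b/a,q)(σ(a,b)) = q^b` and `x ∈ ℕ̄ ⊗_𝔹 ℕ̄⁺ and ℱ(b/a,q)(x) = q^b ⟹ x + σ(a,b) = σ(a,b)` (67).
  Moreover, the following equality holds in `ℕ̄ ⊗_𝔹 ℕ̄⁺`:
  `(q^a ⊗_𝔹 1 + 1 ⊗_𝔹 q^b) σ(a,b) = σ(a,b) σ(a,b)` (68)." (Proof: "`E = {(n,m) ∈ ℕ × ℕ ∣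
  (b/a)n + m ≥ b}`"; "both sides are equal to `σ(2a,2b)`".) **Proposition 6.21.** "(i) The semiring
  `Conv(ℤ × ℤ)` is multiplicatively cancellative. (ii) The homomorphism `γ : ℕ̄ ⊗_𝔹 ℕ̄ → Conv(ℤ × ℤ)`
  coincides with the homomorphism from `ℕ̄ ⊗_𝔹 ℕ̄` to its image in its semiring of quotients.
  (iii) Let `R` be a multiplicatively cancellative semiring and `ρ : ℕ̄ ⊗_𝔹 ℕ̄ → R` a homomorphism
  such that `ρ⁻¹({0}) = {0}`. Then, there exists a unique semiring homomorphism
  `ρ' : Conv(ℤ × ℤ) → R` such that `ρ = ρ' ∘ γ`." (Proof of (i): "An element `x ∈ Conv(ℤ × ℤ)` is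
  uniquely specified by the elements `ℱ(λ,q)(x)` `∀ λ ∈ ℝ₊*` […] if `x ≠ 0` one has `ℱ(λ,q)(x) ≠ 0`
  […] Since the semifield `ℝ₊^max` is multiplicatively cancellative […]". Of (ii): "`γ⁻¹({0}) = {0}`
  […] `∃ c ∈ ℕ̄ ⊗_𝔹 ℕ̄, c ≠ 0, ca = cb ⟹ γ(a) = γ(b)`. To prove (ii) it is enough to prove the
  converse, to show that for any `a, a' ∈ ℕ̄ ⊗_𝔹 ℕ̄` one has `γ(a) = γ(a') ⟹ ∃ c ∈ ℕ̄ ⊗_𝔹 ℕ̄, c ≠ 0,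
  ca = ca'`", with "`c := ∏ σ(a_{i+1} - a_i, b_i - b_{i+1})`" over the extreme points
  `ℰ = ∂Conv(E) = {(a_i,b_i)}`. Of (iii): "`∃ c ≠ 0, ca = cb ⟹ ρ(a) = ρ(b)`. Thus `ρ(a)` only
  depends upon `γ(a)`".) **Definition 6.22.** "The reduced square of the arithmetic site is the
  topos `ℕ̂^{×2}` with the structure sheaf `Conv(ℤ × ℤ)`, viewed as a semiring in the topos."
* §7.1. "the semiring `ℕ̄ ⊗_𝔹 ℕ̄⁺` is generated by the images `ι_j(ℤ_min⁺)` of the two projections,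
  by the morphisms `ι₁(q^n) := q^n ⊗_𝔹 1`, `ι₂(q^n) := 1 ⊗_𝔹 q^n` `∀ n ∈ ℕ`." **Lemma 7.2.** "Let
  `(R, ℓ, r)` be a reduced correspondence over `𝒜`, then there exists a unique semiring
  homomorphism `ρ : Conv(ℕ × ℕ) → R` such that `ℓ = ρ ∘ γ ∘ ι₁` and `r = ρ ∘ γ ∘ ι₂`." (Proof: "By
  Proposition 6.6 there exists a unique `𝔹`-linear map `ρ₀ : ℕ̄ ⊗_𝔹 ℕ̄⁺ → R` such that
  `ρ₀(q^a ⊗_𝔹 q^b) = ℓ(q^a) r(q^b)` `∀ a, b ∈ ℕ`. Moreover `ρ₀` is multiplicative and hence it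
  defines a homomorphism of semirings […] a semiring of characteristic `1` is zero sum free […]
  `x_j ∈ R, ∑ x_j = 0 ⟹ x_j = 0, ∀ j` (59). Indeed, if `a + b = 0` then `a = a + a + b = a + b = 0`.
  As `R` is [multiplicatively cancellative] by hypothesis, it has no zero divisors and
  `ℓ(q^a) r(q^b) ≠ 0` `∀ a, b ∈ ℕ`. This […] shows that `ρ₀⁻¹({0}) = {0}`. We now apply
  Proposition 6.21 (iii) […] Since `γ : ℕ̄ ⊗_𝔹 ℕ̄⁺ → Conv(ℕ × ℕ)` is surjective one gets the
  uniqueness of the homomorphism `ρ`.")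

## Rendering

* `Conv(ℤ × ℤ)` is typed as the QUOTIENT semiring of Prop. 6.19, realised concretely as the image
  `ConvZ2 := envelope.rangeS` of the joint homomorphism `envelope : E ↦ (ℱ(λ,q)(E))_{λ ∈ ℝ₊*}`,
  `ℤ_min ⊗_𝔹 ℤ_min → (ℝ₊* → ℝ₊^max)` (a sub-semiring of a product of copies of `ℝ₊^max = 𝕋`; the
  index type is `PosReal`), and `γ = gammaHom := envelope.rangeSRestrict`. Thus
  `γ(E) = γ(E') ⟺ ℱ(λ,q)(E) = ℱ(λ,q)(E') ∀ λ ∈ ℝ₊*` (`gammaHom_eq_iff`) is the printed congruence and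
  the last sentence of Prop. 6.19 holds by construction. TODO(general form): the geometric
  description of Def. 6.17 (closed convex sets with integral extreme points, `conv(C ∪ C')`,
  `C + C'`) and "`γ(E)` is the convex hull of `E`" are NOT typed; in their place
  `ConnesConsani2016_prop_6_19_halfPlanes` proves the sentence of the printed proof carrying that
  content: `γ(E) = γ(E')` iff `E` and `E'` lie in the same half planes `H_{λ,α}` (`halfPlane`),
  `λ ∈ ℝ₊*` (all `α ∈ ℝ`: elements of `ℤ_min ⊗_𝔹 ℤ_min` are not confined to `α ≥ 0`).
  `Conv(ℕ × ℕ) := γ(ℕ̄ ⊗_𝔹 ℕ̄⁺)` is `convPlus := subPlus.map gammaHom`, with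
  `γ⁺ = gammaPlus : subPlus →+* convPlus` and `ι_j : ℤ_min⁺ → ℕ̄ ⊗_𝔹 ℕ̄⁺` = `iotaPlus₁/₂`. The
  exponent `α = inf_E L_λ` of `ℱ(λ,q)(E) = q^α` (`E ≠ 0`) is `frobExp` (`frobF_eq_texp`). `σ(a,b)`
  is `sigmaElt a b = gen (sigmaPts a b)` verbatim (`Ceiling = ⌈·⌉`). The natural order
  `x ≤ y ⟺ x + y = y ⟺ x ⊂ y` of the idempotent semiring `Sub(ℤ × ℤ)` is the `PartialOrder` instance
  on `SubZ2` (`le_iff_subset`, `le_iff_add_eq`). A reduced correspondence is the companion file's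
  `ReducedCorrespondence` (`C.R`, `C.ell`, `C.r`); "`R` multiplicatively cancellative" (the standing
  hypothesis of §7.1, used in the proof of Lemma 7.2) is the instance argument `[IsCancelMulZero C.R]`.
* What is PROVED: **Lemma 6.18** `ConnesConsani2016_lemma_6_18` (`1 ⊕ 1 = 1` in `Conv(ℤ × ℤ)`; the
  semiring structure is the `Subsemiring`); **Prop. 6.19** `ConnesConsani2016_prop_6_19_i` (the
  `ℱ(λ,q)`-congruence over `λ ∈ ℝ₊*` equals the `μ ∘ Fr_{n,m}`-congruence over `n, m ≥ 1`),
  `gammaHom_eq_iff_mu_frobNM`, `ConnesConsani2016_prop_6_19_halfPlanes`, and the descent of the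
  `ℕ^× × ℕ^×`-action to `Conv(ℤ × ℤ)`: `convFrob`, `gammaHom_frobNM` ("viewed as a semiring in the
  topos", Def. 6.22); **Lemma 6.20** `sigmaElt_carrier` ("`E = {(n,m) ∣ (b/a)n + m ≥ b}`"),
  `ConnesConsani2016_lemma_6_20_frobF` (`ℱ(b/a,q)(σ(a,b)) = q^b`), `ConnesConsani2016_lemma_6_20_absorb`
  (67), `ConnesConsani2016_lemma_6_20_mul` (68); **Prop. 6.21 (i)** the instance
  `ConnesConsani2016_prop_6_21_i : IsCancelMulZero ConvZ2` (with `NoZeroDivisors SubZ2`,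
  `gammaHom_eq_zero_iff` = "`γ⁻¹({0}) = {0}`"), **(ii)** `ConnesConsani2016_prop_6_21_ii`
  (`γ(E) = γ(E') ⟺ ∃ c ≠ 0, cE = cE'`; `exists_cancel_of_gammaHom_eq` gives `c ∈ ℕ̄ ⊗_𝔹 ℕ̄⁺`),
  **(iii)** `liftConv`, `liftConv_gammaHom`, `ConnesConsani2016_prop_6_21_iii` (for any `Semiring R`
  with `IsCancelMulZero R`); **Lemma 7.2** `rho0` (`ρ₀ : ℕ̄ ⊗_𝔹 ℕ̄⁺ →+* R`, `rho0_quad` =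
  "`ρ₀(q^a ⊗_𝔹 q^b) = ℓ(q^a) r(q^b)`", multiplicativity `lift_ellR_mul`), `rho0_eq_zero`
  (`ρ₀⁻¹({0}) = {0}` via (59) = `eq_zero_of_add_eq_zero_charOne` and `ellR_ne_zero`), `rhoConv`,
  `rhoConv_iota₁/₂` and `ConnesConsani2016_lemma_7_2` (`∃! ρ : convPlus →+* R`).
* Deviations from the printed PROOFS (statements as printed): (a) Prop. 6.19 "⟸" is proved from
  `μ ∘ Fr_{n,m} = Fr_m ∘ ℱ(n/m,q)` (Prop. 6.12 (iii), companion file), injectivity of `Fr_m` and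
  the continuity of `λ ↦ inf_E L_λ` together with the density of `ℚ₊*` (`continuous_frobExp`,
  `eq_of_eq_on_pos_rat`), instead of the best-rational-approximation statements Lemma 6.15 /
  Prop. 6.16, which are not typed; (b) in Prop. 6.21 (ii) the bookkeeping of the extreme points
  `ℰ = ∂Conv(E)` is replaced by the elementary support lemma `support_pair` (a lattice point `z`
  lying in all the half planes `H_{λ, inf_E L_λ}`, `λ > 0`, is either above a generator of `E` or
  wedged under two generators `x, y`: `x₁ ≤ z₁ < y₁`, `y₂ ≤ z₂ < x₂`,
  `(y₁-z₁)(x₂-z₂) ≤ (z₂-y₂)(z₁-x₁)`), and the cancelling element is `cFactor E * cFactor E'`, where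
  `cFactor E` is the product of the `σ(y₁-x₁, x₂-y₂)` over ALL such pairs of canonical generators
  (`genPairs`; the printed `c` uses consecutive vertices only); for a wedged `z`,
  `I_z ⊂ I_{(x₁,y₂)} σ(x,y)` (`quad_le_quad_mul_pairSigma`, read off `sigmaElt_carrier`) and (68)
  give `c I_z ⊂ c E` (`cFactor_mul_quad_le`), whence `cE' ⊂ cE` and symmetrically — so the
  preliminary reduction "multiplying `a` and `a'` by `qⁿ ⊗ qⁿ` […] we can assume
  `a, a' ∈ ℕ̄ ⊗_𝔹 ℕ̄⁺`" is not needed; (c) in Lemma 7.2 the values `ℓ(q^a) r(q^b)` are packaged as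
  `ellR` on `ℤ × ℤ` (negative exponents clipped by `Int.toNat`; only `a, b ≥ 0` occur on
  `ℕ̄ ⊗_𝔹 ℕ̄⁺`), `ρ₀ = lift ellR` is the `𝔹`-linear map of Prop. 6.6 (ii) restricted to `subPlus`,
  and the factorisation through `γ⁺` uses `exists_cancel_of_gammaHom_eq` (`c ∈ ℕ̄ ⊗_𝔹 ℕ̄⁺`) exactly
  as Prop. 6.21 (iii).
* NOT typed here: the geometry of Def. 6.17 (above), Remark 6.14 – Prop. 6.16 (best rational
  approximations), the topos `ℕ̂^{×2}` of Def. 6.22 and Remark 6.23 (points of the reduced square).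
-/
noncomputable section

open Set Tropical Pointwise Filter Topology

namespace Literature.NumberTheory.ConnesConsani

local notation "𝕋" => RMaxExp
local notation "ℕ̄" => ZMinPlus

open SubZ2

/-! ## The family `(ℱ(λ,q))_{λ > 0}` and the reduced semiring `Conv(ℤ × ℤ)` -/

/-- The index set `ℝ₊*` of the Frobenius correspondences `ℱ(λ,q)`. [cite: ConnesConsani2016ArithmeticSite, Prop. 6.19 ("`∀ λ ∈ ℝ₊*`")] -/
abbrev PosReal : Type := {l : ℝ // 0 < l}

/-- **The joint map `E ↦ (ℱ(λ,q)(E))_{λ ∈ ℝ₊*}`** on `ℤ_min ⊗_𝔹 ℤ_min`; its kernel congruence is the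
congruence of Prop. 6.19 ("`ℱ(λ,q)(x) = ℱ(λ,q)(y)` `∀ λ ∈ ℝ₊*` […] This defines a congruence relation
on the semiring `ℤ_min ⊗_𝔹 ℤ_min`"). [cite: ConnesConsani2016ArithmeticSite, Prop. 6.19] -/
def envelope : SubZ2 →+* (PosReal → 𝕋) :=
  RingHom.pi fun l : PosReal => frobF l.1 l.2.le

/-- Coordinates of the joint map. [cite: ConnesConsani2016ArithmeticSite, Prop. 6.19] -/
@[simp] theorem envelope_apply (E : SubZ2) (l : PosReal) : envelope E l = frobF l.1 l.2.le E := rfl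

/-- **`Conv(ℤ × ℤ)`, the reduced square's structure semiring**, realised as the quotient semiring of
Prop. 6.19: "The quotient semiring is the semiring `Conv(ℤ × ℤ)`" of `ℤ_min ⊗_𝔹 ℤ_min` by the
congruence "`ℱ(λ,q)(x) = ℱ(λ,q)(y)` `∀ λ ∈ ℝ₊*`", i.e. the image of the joint map `E ↦ (ℱ(λ,q)(E))_λ`.
(Def. 6.17 describes the same semiring geometrically as closed convex `C ⊂ ℝ²` with `C + ℝ₊² = C`,
`C ⊂ z + ℝ₊²`, integral extreme points, with `conv(C ∪ C')` and `C + C'` — TODO(general form): the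
geometric description is not typed here; see the module docstring.)
[cite: ConnesConsani2016ArithmeticSite, Prop. 6.19 and Def. 6.17] -/
abbrev ConvZ2 : Subsemiring (PosReal → 𝕋) := envelope.rangeS

/-- **`γ : ℕ̄ ⊗_𝔹 ℕ̄ → Conv(ℤ × ℤ)`**, "which in terms of the description of `ℕ̄ ⊗_𝔹 ℕ̄` as `Sub(ℤ × ℤ)`
is simply given by `E ↦ γ(E)`, where `γ(E)` is the convex hull of `E`" — here the quotient map.
[cite: ConnesConsani2016ArithmeticSite, §6.4 (before Lemma 6.20)] -/
def gammaHom : SubZ2 →+* ConvZ2 := envelope.rangeSRestrict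

/-- `γ` is surjective ("Since `γ : ℕ̄ ⊗_𝔹 ℕ̄ → Conv(ℕ × ℕ)` is surjective"). [cite: ConnesConsani2016ArithmeticSite, Lemma 7.2 (proof)] -/
theorem gammaHom_surjective : Function.Surjective gammaHom := RingHom.rangeSRestrict_surjective _

/-- `γ(E)` as a tuple. [cite: ConnesConsani2016ArithmeticSite, Prop. 6.19] -/
@[simp] theorem coe_gammaHom (E : SubZ2) : (gammaHom E : PosReal → 𝕋) = envelope E := rfl

/-- `γ(E) = γ(E')` iff `ℱ(λ,q)(E) = ℱ(λ,q)(E')` for all `λ > 0`. [cite: ConnesConsani2016ArithmeticSite, Prop. 6.19] -/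
theorem gammaHom_eq_iff {E E' : SubZ2} :
    gammaHom E = gammaHom E' ↔ ∀ (l : ℝ) (hl : 0 < l), frobF l hl.le E = frobF l hl.le E' := by
  rw [Subtype.ext_iff, coe_gammaHom, coe_gammaHom, funext_iff]
  exact ⟨fun h l hl => h ⟨l, hl⟩, fun h l => h l.1 l.2⟩

/-- **Connes–Consani 2016, Lemma 6.18**: "Endowed with the above two operations `Conv(ℤ × ℤ)` is a
semiring of characteristic `1`." (The semiring structure is that of the sub-semiring `ConvZ2`; here
`1 ⊕ 1 = 1`.) [cite: ConnesConsani2016ArithmeticSite, Lemma 6.18] -/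
theorem ConnesConsani2016_lemma_6_18 : (1 : ConvZ2) + 1 = 1 := by
  have h := congrArg gammaHom SubZ2.one_add_one
  rwa [map_add, map_one] at h

/-! ### `ℱ(λ,q)` on a non-zero element is a `q^α`; `Sub(ℤ × ℤ)` has no zero divisors -/

/-- `E = 0` iff its canonical decomposition is empty. [cite: ConnesConsani2016ArithmeticSite, Lemma 6.5] -/
theorem minGens_eq_empty_iff {E : SubZ2} : E.minGens = ∅ ↔ E = 0 := by
  constructor
  · intro h; rw [eq_sum_minGens E, h, Finset.sum_empty]
  · rintro rfl
    ext z
    simp only [mem_minGens, zero_carrier, Finset.notMem_empty, iff_false]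
    exact fun h => h.prop

/-- Non-zero elements have a non-empty canonical decomposition. [cite: ConnesConsani2016ArithmeticSite, Lemma 6.5] -/
theorem minGens_nonempty {E : SubZ2} (hE : E ≠ 0) : E.minGens.Nonempty :=
  Finset.nonempty_iff_ne_empty.2 fun h => hE (minGens_eq_empty_iff.1 h)

/-- The exponent `α = inf_{x ∈ E} L_λ(x)` of `ℱ(λ,q)(E) = q^α`, `E ≠ 0` (minimum over the canonical
decomposition). [cite: ConnesConsani2016ArithmeticSite, Prop. 6.13 (proof of (i): "`ℱ(λ,q)(E) = q^α`, `α = inf_{x∈E} L_λ(x)`")] -/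
def frobExp (l : ℝ) (E : SubZ2) (hE : E ≠ 0) : ℝ :=
  E.minGens.inf' (minGens_nonempty hE) fun x => l * x.1 + x.2

/-- `ℱ(λ,q)(E) = q^{α}` with `α = frobExp`. [cite: ConnesConsani2016ArithmeticSite, Prop. 6.13 (i)] -/
theorem frobF_eq_texp (l : ℝ) (hl : 0 ≤ l) {E : SubZ2} (hE : E ≠ 0) :
    frobF l hl E = texp (frobExp l E hE) := by
  conv_lhs => rw [← gen_minGens E]
  exact ConnesConsani2016_prop_6_13_i l hl _ (minGens_nonempty hE)

/-- `ℱ(λ,q)(E) ≠ 0` for `E ≠ 0` ("if `x ≠ 0` one has `ℱ(λ,q)(x) ≠ 0`, `∀ λ ∈ ℝ₊*`").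
[cite: ConnesConsani2016ArithmeticSite, Prop. 6.21 (proof of (i))] -/
theorem frobF_ne_zero (l : ℝ) (hl : 0 ≤ l) {E : SubZ2} (hE : E ≠ 0) : frobF l hl E ≠ 0 := by
  rw [frobF_eq_texp l hl hE]; exact texp_ne_zero _

/-- `ℱ(λ,q)(E) = 0 ↔ E = 0`. [cite: ConnesConsani2016ArithmeticSite, Prop. 6.21 (proof of (i))] -/
theorem frobF_eq_zero_iff (l : ℝ) (hl : 0 ≤ l) {E : SubZ2} : frobF l hl E = 0 ↔ E = 0 :=
  ⟨fun h => by_contra fun hE => frobF_ne_zero l hl hE h, fun h => by rw [h, map_zero]⟩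

/-- `E = 0 ↔ E = ∅`. [cite: ConnesConsani2016ArithmeticSite, Lemma 6.4] -/
theorem eq_zero_iff_carrier {E : SubZ2} : E = 0 ↔ E.carrier = ∅ :=
  ⟨fun h => by rw [h, zero_carrier], fun h => SubZ2.ext (by rw [h, zero_carrier])⟩

/-- `Sub(ℤ × ℤ)` has no zero divisors: `E + E' = ∅` only if `E = ∅` or `E' = ∅`.
[cite: ConnesConsani2016ArithmeticSite, §6.4 (before Lemma 6.20: `c ≠ 0`)] -/
instance : NoZeroDivisors SubZ2 where
  eq_zero_or_eq_zero_of_mul_eq_zero {E E'} h := by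
    by_contra hne
    push Not at hne
    obtain ⟨hE, hE'⟩ := hne
    obtain ⟨z, hz⟩ := Set.nonempty_iff_ne_empty.2 (fun h0 => hE (eq_zero_iff_carrier.2 h0))
    obtain ⟨z', hz'⟩ := Set.nonempty_iff_ne_empty.2 (fun h0 => hE' (eq_zero_iff_carrier.2 h0))
    have hmem : z + z' ∈ (E * E').carrier := Set.add_mem_add hz hz'
    rw [h, zero_carrier] at hmem
    exact hmem

/-! ### Prop. 6.21 (i): `Conv(ℤ × ℤ)` is multiplicatively cancellative -/

/-- A non-zero element of `Conv(ℤ × ℤ)` has all its coordinates `ℱ(λ,q)` non-zero.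
[cite: ConnesConsani2016ArithmeticSite, Prop. 6.21 (proof of (i))] -/
theorem ConvZ2.apply_ne_zero {x : ConvZ2} (hx : x ≠ 0) (l : PosReal) : (x : PosReal → 𝕋) l ≠ 0 := by
  obtain ⟨E, rfl⟩ := gammaHom_surjective x
  have hE : E ≠ 0 := fun h => hx (by rw [h, map_zero])
  exact frobF_ne_zero l.1 l.2.le hE

/-- **Connes–Consani 2016, Prop. 6.21 (i)**: "The semiring `Conv(ℤ × ℤ)` is multiplicatively
cancellative." (Proof as printed: coordinatewise in `ℝ₊^max`, using `ℱ(λ,q)(x) ≠ 0` for `x ≠ 0`.)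
[cite: ConnesConsani2016ArithmeticSite, Prop. 6.21 (i)] -/
instance ConnesConsani2016_prop_6_21_i : IsCancelMulZero ConvZ2 where
  mul_left_cancel_of_ne_zero := by
    intro a ha b c h
    apply Subtype.ext
    funext l
    have h' := congr_fun (congrArg Subtype.val h) l
    simp only [Subsemiring.coe_mul, Pi.mul_apply] at h'
    exact mul_left_cancel₀ (ConvZ2.apply_ne_zero ha l) h'
  mul_right_cancel_of_ne_zero := by
    intro b hb a c h
    apply Subtype.ext
    funext l
    have h' := congr_fun (congrArg Subtype.val h) l
    simp only [Subsemiring.coe_mul, Pi.mul_apply] at h'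
    exact mul_right_cancel₀ (ConvZ2.apply_ne_zero hb l) h'

/-! ### Prop. 6.19, first part: the congruence through rational slopes `μ ∘ Fr_{n,m}` -/

/-- `Fr_u` is injective for `u > 0`. [cite: ConnesConsani2016ArithmeticSite, §7.2 (`Fr_u ∈ Aut(ℝ₊^max)`)] -/
theorem frob_injective {u : ℝ} (hu : 0 < u) : Function.Injective (frob u hu.le) := by
  intro x y h
  rcases eq_zero_or_eq_texp x with rfl | ⟨a, rfl⟩ <;>
    rcases eq_zero_or_eq_texp y with rfl | ⟨b, rfl⟩
  · rfl
  · rw [frob_zero', frob_texp] at h; exact absurd h.symm (texp_ne_zero _)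
  · rw [frob_zero', frob_texp] at h; exact absurd h (texp_ne_zero _)
  · rw [frob_texp, frob_texp, texp_inj] at h
    rw [mul_left_cancel₀ hu.ne' h]

/-- `ℤ_min ↪ ℝ₊^max` is injective. [cite: ConnesConsani2016ArithmeticSite, Prop. 6.12 (iii)] -/
theorem zminToT_injective : Function.Injective zminToT := by
  intro x y h
  rcases eq_zero_or_eq_zexp x with rfl | ⟨a, rfl⟩ <;>
    rcases eq_zero_or_eq_zexp y with rfl | ⟨b, rfl⟩
  · rfl
  · rw [map_zero, zminToT_zexp] at h; exact absurd h.symm (texp_ne_zero _)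
  · rw [map_zero, zminToT_zexp] at h; exact absurd h (texp_ne_zero _)
  · rw [zminToT_zexp, zminToT_zexp, texp_inj] at h
    have : a = b := by exact_mod_cast h
    rw [this]

/-- `ℱ(λ,q)` only depends on `λ`. [cite: ConnesConsani2016ArithmeticSite, Prop. 6.13 (i)] -/
theorem frobF_congr {l l' : ℝ} (h : l = l') (hl : 0 ≤ l) (hl' : 0 ≤ l') : frobF l hl = frobF l' hl' := by
  subst h; rfl

/-- `ℱ(λ,q) ∘ Fr_{n,m} = Fr_m ∘ ℱ(λn/m, q)`. [cite: ConnesConsani2016ArithmeticSite, Prop. 6.12 (iii) and Prop. 6.16 (proof)] -/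
theorem frobF_comp_frobNM (l : ℝ) (hl : 0 ≤ l) (n m : ℕ) (hm : 0 < m) :
    (frobF l hl).comp (frobNM n m) =
      (frob m (Nat.cast_nonneg m)).comp (frobF (l * n / m) (by positivity)) :=
  ringHom_ext fun x => by
    simp only [RingHom.comp_apply, frobNM_quad, frobPair, frobF_quad, frob_texp]
    push_cast
    congr 1
    field_simp

/-- The exponent function `λ ↦ inf_{x ∈ E} L_λ(x)` is continuous (a minimum of finitely many affine
functions). [cite: ConnesConsani2016ArithmeticSite, Prop. 6.16 (proof: comparison of `aλ + b` with `a'λ + b'`)] -/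
theorem continuous_frobExp {E : SubZ2} (hE : E ≠ 0) : Continuous fun l => frobExp l E hE := by
  unfold frobExp
  exact Continuous.finset_inf'_apply _ fun x _ => by fun_prop

/-- Two continuous real functions that agree at all positive rationals agree at all positive reals
(rational approximation, the role of Lemma 6.15/Prop. 6.16). [cite: ConnesConsani2016ArithmeticSite, Prop. 6.16] -/
theorem eq_of_eq_on_pos_rat {f g : ℝ → ℝ} (hf : Continuous f) (hg : Continuous g)
    (h : ∀ q : ℚ, 0 < (q : ℝ) → f q = g q) {l : ℝ} (hl : 0 < l) : f l = g l := by
  -- a sequence of rationals `l < r_k < l + 1/(k+1)`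
  have hr : ∀ k : ℕ, ∃ r : ℚ, l < r ∧ (r : ℝ) < l + 1 / ((k : ℝ) + 1) := fun k =>
    exists_rat_btwn (lt_add_of_pos_right l (by positivity))
  choose r hr1 hr2 using hr
  have hlim : Tendsto (fun k => (r k : ℝ)) atTop (𝓝 l) := by
    refine tendsto_of_tendsto_of_tendsto_of_le_of_le tendsto_const_nhds ?_
      (fun k => (hr1 k).le) (fun k => (hr2 k).le)
    have : Tendsto (fun k : ℕ => l + 1 / ((k : ℝ) + 1)) atTop (𝓝 (l + 0)) :=
      tendsto_const_nhds.add tendsto_one_div_add_atTop_nhds_zero_nat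
    rwa [add_zero] at this
  have hf' := (hf.tendsto l).comp hlim
  have hg' := (hg.tendsto l).comp hlim
  have heq : (f ∘ fun k => (r k : ℝ)) = (g ∘ fun k => (r k : ℝ)) := by
    funext k
    exact h (r k) (hl.trans (hr1 k))
  rw [heq] at hf'
  exact tendsto_nhds_unique hf' hg'

/-- **Connes–Consani 2016, Prop. 6.19, first part**: "Let `x, y ∈ ℤ_min ⊗_𝔹 ℤ_min`. One has:
`ℱ(λ,q)(x) = ℱ(λ,q)(y)` `∀ λ ∈ ℝ₊*` if and only if `μ ∘ Fr_{n,m}(x) = μ ∘ Fr_{n,m}(y)` for all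
pairs of positive integers `n, m ∈ ℕ`." (⟸ by continuity in `λ` and density of `ℚ₊*`, in place of
the best-rational-approximation Lemma 6.15/Prop. 6.16.) [cite: ConnesConsani2016ArithmeticSite, Prop. 6.19] -/
theorem ConnesConsani2016_prop_6_19_i (E E' : SubZ2) :
    (∀ (l : ℝ) (hl : 0 < l), frobF l hl.le E = frobF l hl.le E') ↔
      ∀ n m : ℕ, 0 < n → 0 < m → mu (frobNM n m E) = mu (frobNM n m E') := by
  constructor
  · intro h n m hn hm
    apply zminToT_injective
    have e := fun X => congrArg (fun φ : SubZ2 →+* 𝕋 => φ X) (ConnesConsani2016_prop_6_12_iii n m hm)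
    simp only [RingHom.comp_apply] at e
    rw [e, e, h ((n : ℝ) / m) (by positivity)]
  · intro h
    -- equality at positive rationals
    have hrat : ∀ (q : ℚ) (hq : 0 < (q : ℝ)), frobF q hq.le E = frobF q hq.le E' := by
      intro q hq
      have hq' : 0 < q := by exact_mod_cast hq
      have hnum : 0 < q.num := Rat.num_pos.2 hq'
      set n : ℕ := q.num.toNat with hn
      have hn0 : 0 < n := by rw [hn]; omega
      have hm0 : 0 < q.den := q.den_pos
      have hq_eq : ((n : ℝ) / q.den) = (q : ℝ) := by
        rw [hn]
        have : ((q.num.toNat : ℕ) : ℝ) = (q.num : ℝ) := by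
          rw [show ((q.num.toNat : ℕ) : ℝ) = ((q.num.toNat : ℤ) : ℝ) by norm_cast,
            Int.toNat_of_nonneg hnum.le]
        rw [this, Rat.cast_def]
      have e := fun X => congrArg (fun φ : SubZ2 →+* 𝕋 => φ X) (ConnesConsani2016_prop_6_12_iii n q.den hm0)
      simp only [RingHom.comp_apply] at e
      have key : frob q.den (Nat.cast_nonneg _) (frobF ((n : ℝ) / q.den) (by positivity) E) =
          frob q.den (Nat.cast_nonneg _) (frobF ((n : ℝ) / q.den) (by positivity) E') := by
        rw [← e, ← e, h n q.den hn0 hm0]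
      have key' := frob_injective (by exact_mod_cast hm0) key
      have e1 : frobF ((n : ℝ) / q.den) (by positivity) = frobF q hq.le := frobF_congr hq_eq _ _
      rwa [e1] at key'
    intro l hl
    by_cases hE : E = 0
    · subst hE
      have h1 := hrat 1 (by norm_num)
      rw [map_zero, eq_comm, frobF_eq_zero_iff] at h1
      rw [h1]
    by_cases hE' : E' = 0
    · subst hE'
      have h1 := hrat 1 (by norm_num)
      rw [map_zero, frobF_eq_zero_iff] at h1
      exact absurd h1 hE
    rw [frobF_eq_texp l hl.le hE, frobF_eq_texp l hl.le hE', texp_inj]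
    refine eq_of_eq_on_pos_rat (continuous_frobExp hE) (continuous_frobExp hE') (fun q hq => ?_) hl
    have := hrat q hq
    rwa [frobF_eq_texp _ _ hE, frobF_eq_texp _ _ hE', texp_inj] at this

/-- **Prop. 6.19, first part, for `γ`**: `γ(x) = γ(y)` iff `μ ∘ Fr_{n,m}(x) = μ ∘ Fr_{n,m}(y)` for all
`n, m ≥ 1`. [cite: ConnesConsani2016ArithmeticSite, Prop. 6.19] -/
theorem gammaHom_eq_iff_mu_frobNM {E E' : SubZ2} :
    gammaHom E = gammaHom E' ↔ ∀ n m : ℕ, 0 < n → 0 < m → mu (frobNM n m E) = mu (frobNM n m E') :=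
  gammaHom_eq_iff.trans (ConnesConsani2016_prop_6_19_i E E')

/-! ### Prop. 6.19, last part: classes of `γ` are cut out by the supporting half planes `H_{λ,α}` -/

/-- The half planes "`H_{λ,α} := {(x,y) ∈ ℝ² ∣ λx + y ≥ α}`, `λ ∈ ℝ₊*`" (their lattice points).
[cite: ConnesConsani2016ArithmeticSite, Prop. 6.19 (proof)] -/
def halfPlane (l α : ℝ) : Set (ℤ × ℤ) := {z | α ≤ l * z.1 + z.2}

/-- `inf_E L_λ ≤ L_λ(z)` for `z ∈ E` (`λ ≥ 0`). [cite: ConnesConsani2016ArithmeticSite, Prop. 6.13 (proof of (i))] -/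
theorem frobExp_le_of_mem {l : ℝ} (hl : 0 ≤ l) {E : SubZ2} (hE : E ≠ 0) {z : ℤ × ℤ} (hz : z ∈ E.carrier) :
    frobExp l E hE ≤ l * z.1 + z.2 := by
  obtain ⟨m, hm, hmz⟩ := exists_minGens_le hz
  refine (Finset.inf'_le (fun x : ℤ × ℤ => l * x.1 + x.2) hm).trans ?_
  have h1 : (m.1 : ℝ) ≤ z.1 := by exact_mod_cast hmz.1
  have h2 : (m.2 : ℝ) ≤ z.2 := by exact_mod_cast hmz.2
  have h3 := mul_le_mul_of_nonneg_left h1 hl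
  show l * (m.1 : ℝ) + m.2 ≤ l * z.1 + z.2
  linarith

/-- `inf_E L_λ` is attained on `E`. [cite: ConnesConsani2016ArithmeticSite, Prop. 6.13 (proof of (i))] -/
theorem exists_mem_frobExp_eq (l : ℝ) {E : SubZ2} (hE : E ≠ 0) :
    ∃ z ∈ E.carrier, l * z.1 + z.2 = frobExp l E hE := by
  obtain ⟨g, hg, hgeq⟩ := Finset.exists_mem_eq_inf' (minGens_nonempty hE) fun x : ℤ × ℤ => l * x.1 + x.2
  exact ⟨g, (mem_minGens.1 hg).prop, hgeq.symm⟩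

/-- `E ⊂ H_{λ,α} ⟺ α ≤ inf_E L_λ` (`λ ≥ 0`, `E ≠ 0`). [cite: ConnesConsani2016ArithmeticSite, Prop. 6.19 (proof)] -/
theorem subset_halfPlane_iff {l : ℝ} (hl : 0 ≤ l) {E : SubZ2} (hE : E ≠ 0) (α : ℝ) :
    E.carrier ⊆ halfPlane l α ↔ α ≤ frobExp l E hE := by
  constructor
  · intro h
    obtain ⟨z, hz, hzeq⟩ := exists_mem_frobExp_eq l hE
    rw [← hzeq]
    exact h hz
  · intro h z hz
    exact h.trans (frobExp_le_of_mem hl hE hz)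

/-- Only `∅` is contained in every half plane `H_{λ,α}` (`λ` fixed). [cite: ConnesConsani2016ArithmeticSite, Prop. 6.19 (proof)] -/
theorem eq_zero_of_halfPlanes {E E' : SubZ2} {l : ℝ}
    (h : ∀ α : ℝ, E.carrier ⊆ halfPlane l α → E'.carrier ⊆ halfPlane l α) (hE : E = 0) : E' = 0 := by
  by_contra hE'
  obtain ⟨z, hz⟩ := Set.nonempty_iff_ne_empty.2 fun h0 => hE' (eq_zero_iff_carrier.2 h0)
  have := h (l * z.1 + z.2 + 1) (by rw [hE, zero_carrier]; exact Set.empty_subset _) hz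
  simp only [halfPlane, Set.mem_setOf_eq] at this
  linarith

/-- **Connes–Consani 2016, Prop. 6.19, last part**: "The quotient semiring is the semiring
`Conv(ℤ × ℤ)`. […] This follows since the convex closure of any `E ∈ Sub(ℤ × ℤ)` is obtained as the
intersection of the half planes of the form `H_{λ,α} := {(x,y) ∈ ℝ² ∣ λx + y ≥ α}`, `λ ∈ ℝ₊*`,
`α ≥ 0` which contain `E`": two elements of `ℤ_min ⊗_𝔹 ℤ_min` have the same class in `Conv(ℤ × ℤ)`
iff they lie in the same half planes `H_{λ,α}`, `λ ∈ ℝ₊*` (all `α ∈ ℝ`, the elements of `ℤ_min ⊗ ℤ_min`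
not being confined to the positive quadrant). [cite: ConnesConsani2016ArithmeticSite, Prop. 6.19] -/
theorem ConnesConsani2016_prop_6_19_halfPlanes (E E' : SubZ2) :
    gammaHom E = gammaHom E' ↔
      ∀ l : ℝ, 0 < l → ∀ α : ℝ, (E.carrier ⊆ halfPlane l α ↔ E'.carrier ⊆ halfPlane l α) := by
  rw [gammaHom_eq_iff]
  constructor
  · intro h l hl α
    by_cases hE : E = 0
    · have hE' : E' = 0 := by
        have := h l hl
        rwa [hE, map_zero, eq_comm, frobF_eq_zero_iff] at this
      rw [hE, hE']
    have hE' : E' ≠ 0 := fun h0 => hE (by have := h l hl; rwa [h0, map_zero, frobF_eq_zero_iff] at this)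
    have e := h l hl
    rw [frobF_eq_texp l hl.le hE, frobF_eq_texp l hl.le hE', texp_inj] at e
    rw [subset_halfPlane_iff hl.le hE, subset_halfPlane_iff hl.le hE', e]
  · intro h l hl
    by_cases hE : E = 0
    · rw [hE, eq_zero_of_halfPlanes (fun α => (h l hl α).1) hE]
    by_cases hE' : E' = 0
    · rw [hE', eq_zero_of_halfPlanes (fun α => (h l hl α).2) hE']
    rw [frobF_eq_texp l hl.le hE, frobF_eq_texp l hl.le hE', texp_inj]
    apply le_antisymm
    · exact (subset_halfPlane_iff hl.le hE' _).1 ((h l hl _).1 ((subset_halfPlane_iff hl.le hE _).2 le_rfl))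
    · exact (subset_halfPlane_iff hl.le hE _).1 ((h l hl _).2 ((subset_halfPlane_iff hl.le hE' _).2 le_rfl))

/-! ### The Frobenius action descends to `Conv(ℤ × ℤ)` (the structure sheaf of the reduced square, Def. 6.22) -/

/-- Reindexing of `ℝ₊*` by `λ ↦ λ n / m`. [cite: ConnesConsani2016ArithmeticSite, Prop. 6.7 (iii) and Def. 6.22] -/
def scaleIdx (n m : ℕ) (hn : 0 < n) (hm : 0 < m) (l : PosReal) : PosReal :=
  ⟨l.1 * n / m, by have := l.2; positivity⟩

/-- The endomorphism `x ↦ (Fr_m(x_{λn/m}))_λ` of `ℝ₊*`-tuples, under which the joint map intertwines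
`Fr_{n,m}`. [cite: ConnesConsani2016ArithmeticSite, Prop. 6.7 (iii) and Def. 6.22] -/
def tupleFrob (n m : ℕ) (hn : 0 < n) (hm : 0 < m) : (PosReal → 𝕋) →+* (PosReal → 𝕋) where
  toFun x l := frob m (Nat.cast_nonneg m) (x (scaleIdx n m hn hm l))
  map_zero' := by funext l; simp
  map_one' := by funext l; simp
  map_mul' x y := by funext l; simp
  map_add' x y := by funext l; simp

/-- `envelope ∘ Fr_{n,m} = tupleFrob ∘ envelope`. [cite: ConnesConsani2016ArithmeticSite, Prop. 6.19 ("This defines a congruence relation") and Def. 6.22] -/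
theorem envelope_frobNM (n m : ℕ) (hn : 0 < n) (hm : 0 < m) (E : SubZ2) :
    envelope (frobNM n m E) = tupleFrob n m hn hm (envelope E) := by
  funext l
  have e := congrArg (fun φ : SubZ2 →+* 𝕋 => φ E) (frobF_comp_frobNM l.1 l.2.le n m hm)
  simp only [RingHom.comp_apply] at e
  exact e

/-- **`Fr_{n,m}` on `Conv(ℤ × ℤ)`** (`n, m ≥ 1`): the action of `ℕ^× × ℕ^×` descends through `γ`
("`Conv(ℤ × ℤ)`, viewed as a semiring in the topos `ℕ̂^{×2}`"). [cite: ConnesConsani2016ArithmeticSite, Def. 6.22] -/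
def convFrob (n m : ℕ) (hn : 0 < n) (hm : 0 < m) : ConvZ2 →+* ConvZ2 :=
  ((tupleFrob n m hn hm).restrict ConvZ2 ConvZ2 fun x hx => by
    obtain ⟨E, rfl⟩ := RingHom.mem_rangeS.1 hx
    exact RingHom.mem_rangeS.2 ⟨frobNM n m E, envelope_frobNM n m hn hm E⟩)

/-- **`γ` is equivariant**: `γ(Fr_{n,m}(E)) = Fr_{n,m}(γ(E))`. [cite: ConnesConsani2016ArithmeticSite, Def. 6.22] -/
theorem gammaHom_frobNM (n m : ℕ) (hn : 0 < n) (hm : 0 < m) (E : SubZ2) :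
    gammaHom (frobNM n m E) = convFrob n m hn hm (gammaHom E) :=
  Subtype.ext (envelope_frobNM n m hn hm E)

/-! ## The absorption order of `Sub(ℤ × ℤ)`: `X ≤ Y ⟺ X ⊕ Y = Y ⟺ X ⊂ Y` -/

namespace SubZ2

/-- The natural order of the idempotent semiring `Sub(ℤ × ℤ)`: inclusion of subsets.
[cite: ConnesConsani2016ArithmeticSite, Lemma 6.20 ("`x + σ(a,b) = σ(a,b)`")] -/
instance : PartialOrder SubZ2 where
  le X Y := X.carrier ⊆ Y.carrier
  le_refl X := subset_rfl
  le_trans X Y Z h h' := h.trans h'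
  le_antisymm X Y h h' := SubZ2.ext (h.antisymm h')

/-- `X ≤ Y` is inclusion. [cite: ConnesConsani2016ArithmeticSite, Lemma 6.20] -/
theorem le_iff_subset {X Y : SubZ2} : X ≤ Y ↔ X.carrier ⊆ Y.carrier := Iff.rfl

/-- `X ≤ Y ⟺ X ⊕ Y = Y`. [cite: ConnesConsani2016ArithmeticSite, Lemma 6.20 eq. (66)] -/
theorem le_iff_add_eq {X Y : SubZ2} : X ≤ Y ↔ X + Y = Y := by
  rw [le_iff_subset, SubZ2.ext_iff, add_carrier, Set.union_eq_right]

/-- Multiplication is monotone. [cite: ConnesConsani2016ArithmeticSite, Prop. 6.21 (proof of (ii): "Multiplying by `c`")] -/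
theorem mul_le_mul_left {X Y : SubZ2} (h : X ≤ Y) (Z : SubZ2) : Z * X ≤ Z * Y := by
  rw [le_iff_subset, mul_carrier, mul_carrier]
  exact Set.add_subset_add_left h

/-- Multiplication is monotone. [cite: ConnesConsani2016ArithmeticSite, Prop. 6.21 (proof of (ii))] -/
theorem mul_le_mul_right {X Y : SubZ2} (h : X ≤ Y) (Z : SubZ2) : X * Z ≤ Y * Z := by
  rw [mul_comm X, mul_comm Y]; exact mul_le_mul_left h Z

/-- `X ≤ X ⊕ Y`. [cite: ConnesConsani2016ArithmeticSite, Lemma 6.4] -/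
theorem le_add_right (X Y : SubZ2) : X ≤ X + Y := Set.subset_union_left

/-- `Y ≤ X ⊕ Y`. [cite: ConnesConsani2016ArithmeticSite, Lemma 6.4] -/
theorem le_add_left (X Y : SubZ2) : Y ≤ X + Y := Set.subset_union_right

/-- `X ⊕ Y ≤ Z` from `X ≤ Z`, `Y ≤ Z`. [cite: ConnesConsani2016ArithmeticSite, Lemma 6.4] -/
theorem add_le {X Y Z : SubZ2} (hX : X ≤ Z) (hY : Y ≤ Z) : X + Y ≤ Z := Set.union_subset hX hY

/-- A finite sum of elements `≤ Z` is `≤ Z`. [cite: ConnesConsani2016ArithmeticSite, Lemma 6.4] -/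
theorem sum_le {ι : Type*} (S : Finset ι) (f : ι → SubZ2) {Z : SubZ2} (h : ∀ i ∈ S, f i ≤ Z) :
    ∑ i ∈ S, f i ≤ Z := by
  classical
  induction S using Finset.induction_on with
  | empty => rw [Finset.sum_empty]; exact fun z hz => by simp at hz
  | insert a S ha ih =>
    rw [Finset.sum_insert ha]
    exact add_le (h a (Finset.mem_insert_self a S)) (ih fun i hi => h i (Finset.mem_insert_of_mem hi))

/-- `I_z ≤ E` iff `z ∈ E`. [cite: ConnesConsani2016ArithmeticSite, Def. 6.3 (hereditary)] -/
theorem quad_le_iff {z : ℤ × ℤ} {E : SubZ2} : quad z ≤ E ↔ z ∈ E.carrier := by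
  rw [le_iff_subset, quad_carrier]
  exact ⟨fun h => h Set.self_mem_Ici, fun h w hw => E.isUpperSet (Set.mem_Ici.1 hw) h⟩

/-- Canonical generators lie in `E`. [cite: ConnesConsani2016ArithmeticSite, Lemma 6.5] -/
theorem quad_le_of_mem_minGens {E : SubZ2} {z : ℤ × ℤ} (hz : z ∈ E.minGens) : quad z ≤ E :=
  quad_le_iff.2 (mem_minGens.1 hz).prop

end SubZ2

/-! ## Lemma 6.20: the elements `σ(a,b)` -/

/-- The generators `(a - j, Ceiling(bj/a))`, `0 ≤ j ≤ a`, of `σ(a,b)`. [cite: ConnesConsani2016ArithmeticSite, Lemma 6.20] -/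
def sigmaPts (a b : ℕ) : Finset (ℤ × ℤ) :=
  (Finset.range (a + 1)).image fun j : ℕ => (((a : ℤ) - (j : ℤ)), ⌈((b : ℝ) * (j : ℝ)) / (a : ℝ)⌉)

/-- **`σ(a,b) := ∑_{0 ≤ j ≤ a} q^{a-j} ⊗_𝔹 q^{Ceiling(bj/a)} ∈ ℕ̄ ⊗_𝔹 ℕ̄`**.
[cite: ConnesConsani2016ArithmeticSite, Lemma 6.20] -/
def sigmaElt (a b : ℕ) : SubZ2 := gen (sigmaPts a b)

/-- "`E = {(n,m) ∈ ℕ × ℕ ∣ (b/a)n + m ≥ b}`" — the subset of `σ(a,b)`, here as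
`{z ≥ 0 ∣ b z₁ + a z₂ ≥ ab}`. [cite: ConnesConsani2016ArithmeticSite, Lemma 6.20 (proof)] -/
theorem sigmaElt_carrier {a : ℕ} (ha : 0 < a) (b : ℕ) :
    (sigmaElt a b).carrier = {z : ℤ × ℤ | 0 ≤ z.1 ∧ 0 ≤ z.2 ∧ (a : ℤ) * b ≤ b * z.1 + a * z.2} := by
  have ha' : (0 : ℝ) < a := by exact_mod_cast ha
  ext z
  simp only [sigmaElt, mem_gen, sigmaPts, Finset.mem_image, Finset.mem_range, Set.mem_setOf_eq]
  constructor
  · rintro ⟨_, ⟨j, hj, rfl⟩, hle⟩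
    obtain ⟨h1, h2⟩ := Prod.mk_le_mk.1 hle
    have hceil : ((b : ℝ) * j) / a ≤ (z.2 : ℝ) := Int.ceil_le.1 h2
    have h3 : (b : ℝ) * j ≤ z.2 * a := (div_le_iff₀ ha').1 hceil
    have h3' : (b : ℤ) * j ≤ z.2 * a := by exact_mod_cast h3
    have hc0 : (0 : ℤ) ≤ ⌈((b : ℝ) * (j : ℝ)) / (a : ℝ)⌉ := Int.ceil_nonneg (by positivity)
    have hj' : (j : ℤ) ≤ a := by exact_mod_cast Nat.lt_succ_iff.1 hj
    refine ⟨by omega, by omega, ?_⟩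
    nlinarith
  · rintro ⟨h01, h02, h⟩
    by_cases hz1 : (a : ℤ) ≤ z.1
    · refine ⟨_, ⟨0, by omega, rfl⟩, Prod.mk_le_mk.2 ⟨?_, ?_⟩⟩
      · simpa using hz1
      · simpa using h02
    · refine ⟨_, ⟨((a : ℤ) - z.1).toNat, by omega, rfl⟩, Prod.mk_le_mk.2 ⟨?_, ?_⟩⟩
      · omega
      · rw [Int.ceil_le]
        have e : (((((a : ℤ) - z.1).toNat : ℕ) : ℝ)) = (a : ℝ) - z.1 := by
          have : ((((a : ℤ) - z.1).toNat : ℤ)) = (a : ℤ) - z.1 := Int.toNat_of_nonneg (by omega)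
          exact_mod_cast this
        rw [e, div_le_iff₀ ha']
        have h' : ((a : ℝ) * b) ≤ b * z.1 + a * z.2 := by exact_mod_cast h
        nlinarith

/-- `σ(a,b) ∈ ℕ̄ ⊗_𝔹 ℕ̄⁺ = Sub(ℕ × ℕ)`. [cite: ConnesConsani2016ArithmeticSite, Lemma 6.20 ("`σ(a,b) ∈ ℕ̄ ⊗_𝔹 ℕ̄`")] -/
theorem sigmaElt_mem_subPlus {a : ℕ} (ha : 0 < a) (b : ℕ) : sigmaElt a b ∈ subPlus := by
  intro z hz
  rw [sigmaElt_carrier ha] at hz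
  exact Set.mem_Ici.2 (Prod.mk_le_mk.2 ⟨hz.1, hz.2.1⟩)

/-- `(a, 0) ∈ σ(a,b)`, so `σ(a,b) ≠ 0`. [cite: ConnesConsani2016ArithmeticSite, Lemma 6.20] -/
theorem sigmaElt_ne_zero {a : ℕ} (ha : 0 < a) (b : ℕ) : sigmaElt a b ≠ 0 := by
  intro h
  have hmem : (((a : ℤ)), (0 : ℤ)) ∈ (sigmaElt a b).carrier := by
    rw [sigmaElt_carrier ha]
    exact ⟨by simp, le_rfl, by simp [mul_comm]⟩
  rw [h, zero_carrier] at hmem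
  exact hmem

/-- **Lemma 6.20, first claim**: "`ℱ(b/a,q)(σ(a,b)) = q^b`" (for `a, b ≠ 0`; indeed for `a ≠ 0`).
[cite: ConnesConsani2016ArithmeticSite, Lemma 6.20] -/
theorem ConnesConsani2016_lemma_6_20_frobF {a : ℕ} (ha : 0 < a) (b : ℕ) :
    frobF ((b : ℝ) / a) (by positivity) (sigmaElt a b) = texp b := by
  have ha' : (0 : ℝ) < a := by exact_mod_cast ha
  have hne : (sigmaPts a b).Nonempty := ⟨_, Finset.mem_image.2 ⟨0, by simp, rfl⟩⟩
  rw [sigmaElt, ConnesConsani2016_prop_6_13_i _ _ _ hne, texp_inj]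
  refine le_antisymm ?_ ?_
  · refine (Finset.inf'_le _ (Finset.mem_image.2 ⟨0, by simp, rfl⟩)).trans (le_of_eq ?_)
    simp only [CharP.cast_eq_zero, sub_zero, mul_zero, zero_div, Int.ceil_zero, Int.cast_zero, add_zero,
      Int.cast_natCast]
    rw [div_mul_cancel₀ _ ha'.ne']
  · refine Finset.le_inf' _ _ fun x hx => ?_
    obtain ⟨j, -, rfl⟩ := Finset.mem_image.1 hx
    simp only [Int.cast_sub, Int.cast_natCast]
    have hceil : ((b : ℝ) * j) / a ≤ ((⌈((b : ℝ) * j) / a⌉ : ℤ) : ℝ) := Int.le_ceil _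
    have e : (b : ℝ) / a * ((a : ℝ) - j) = b - b * j / a := by field_simp
    rw [e]
    linarith

/-- **Lemma 6.20, eq. (66)**: "`x ∈ ℕ̄ ⊗_𝔹 ℕ̄⁺` and `ℱ(b/a,q)(x) = q^b ⟹ x + σ(a,b) = σ(a,b)`."
[cite: ConnesConsani2016ArithmeticSite, Lemma 6.20 eq. (66)] -/
theorem ConnesConsani2016_lemma_6_20_absorb {a : ℕ} (ha : 0 < a) (b : ℕ) {x : SubZ2} (hx : x ∈ subPlus)
    (hFx : frobF ((b : ℝ) / a) (by positivity) x = texp b) : x + sigmaElt a b = sigmaElt a b := by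
  have ha' : (0 : ℝ) < a := by exact_mod_cast ha
  have hx0 : x ≠ 0 := by
    intro h; rw [h, map_zero] at hFx; exact texp_ne_zero _ hFx.symm
  rw [frobF_eq_texp _ _ hx0, texp_inj] at hFx
  rw [← SubZ2.le_iff_add_eq, SubZ2.le_iff_subset, sigmaElt_carrier ha]
  intro z hz
  obtain ⟨m, hm, hmz⟩ := exists_minGens_le hz
  have hm0 : 0 ≤ m := mem_subPlus_iff_minGens.1 hx m hm
  have hinf : (b : ℝ) ≤ (b : ℝ) / a * m.1 + m.2 := by
    have h0 : frobExp ((b : ℝ) / a) x hx0 ≤ (b : ℝ) / a * m.1 + m.2 :=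
      Finset.inf'_le (fun x : ℤ × ℤ => (b : ℝ) / a * x.1 + x.2) hm
    rwa [hFx] at h0
  have h1 : (a : ℝ) * b ≤ b * m.1 + a * m.2 := by
    have := mul_le_mul_of_nonneg_left hinf ha'.le
    rw [mul_add, ← mul_assoc, mul_div_cancel₀ _ ha'.ne'] at this
    linarith
  have h1' : (a : ℤ) * b ≤ b * m.1 + a * m.2 := by exact_mod_cast h1
  obtain ⟨hm1, hm2⟩ := Prod.le_def.1 hmz
  obtain ⟨h01, h02⟩ := Prod.le_def.1 hm0
  simp only [Prod.fst_zero, Prod.snd_zero] at h01 h02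
  refine ⟨h01.trans hm1, h02.trans hm2, ?_⟩
  nlinarith

/-- **Lemma 6.20, eq. (67)**: "the following equality holds in `ℕ̄ ⊗_𝔹 ℕ̄⁺`:
`(q^a ⊗_𝔹 1 + 1 ⊗_𝔹 q^b) σ(a,b) = σ(a,b) σ(a,b)`" (`a, b ≠ 0`). (Proved on the subsets:
`(I_{(a,0)} ∪ I_{(0,b)}) + S = S + S` for `S = {z ≥ 0 ∣ bz₁ + az₂ ≥ ab}`; the printed proof shows both
sides equal `σ(2a,2b)`.) [cite: ConnesConsani2016ArithmeticSite, Lemma 6.20 eq. (67)] -/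
theorem ConnesConsani2016_lemma_6_20_mul {a b : ℕ} (ha : 0 < a) (hb : 0 < b) :
    (quad (((a : ℤ)), 0) + quad (0, ((b : ℤ)))) * sigmaElt a b = sigmaElt a b * sigmaElt a b := by
  apply SubZ2.ext
  rw [mul_carrier, mul_carrier, add_carrier, quad_carrier, quad_carrier, sigmaElt_carrier ha]
  have hab : (0 : ℤ) < a * b := by positivity
  ext t
  simp only [Set.mem_add, Set.mem_union, Set.mem_Ici, Set.mem_setOf_eq]
  constructor
  · rintro ⟨u, hu, s, ⟨hs1, hs2, hs⟩, rfl⟩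
    rcases hu with hu | hu
    · obtain ⟨hu1, hu2⟩ := Prod.mk_le_mk.1 hu
      exact ⟨u, ⟨by omega, hu2, by nlinarith⟩, s, ⟨hs1, hs2, hs⟩, rfl⟩
    · obtain ⟨hu1, hu2⟩ := Prod.mk_le_mk.1 hu
      exact ⟨u, ⟨hu1, by omega, by nlinarith⟩, s, ⟨hs1, hs2, hs⟩, rfl⟩
  · rintro ⟨s, ⟨hs1, hs2, hs⟩, s', ⟨hs1', hs2', hs'⟩, rfl⟩
    by_cases h1 : (a : ℤ) ≤ s.1 + s'.1
    · refine ⟨((a : ℤ), 0), Or.inl le_rfl, (s.1 + s'.1 - a, s.2 + s'.2),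
        ⟨by simp only; omega, by simp only; omega, by simp only; nlinarith⟩, ?_⟩
      ext <;> simp
    · refine ⟨(0, ((b : ℤ))), Or.inr le_rfl, (s.1 + s'.1, s.2 + s'.2 - b),
        ⟨by simp only; omega, by simp only; nlinarith, by simp only; nlinarith⟩, ?_⟩
      ext <;> simp

/-! ## The support lemma (the geometric core of Prop. 6.21 (ii)) -/

/-- **Support lemma.** If the integer point `z` lies on or above the lower envelope of the finite set
`G` for every slope `λ > 0` (`min_{g∈G}(λg₁ + g₂) ≤ λz₁ + z₂`), then either `z ≥ g` for some `g ∈ G`, or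
`z` lies in the region above the segment joining two points `x, y ∈ G` with `x₁ ≤ z₁ < y₁`,
`y₂ ≤ z₂ < x₂`. (This replaces the extreme-point bookkeeping `ℰ = ∂Conv(E)` of the printed proof of
Prop. 6.21 (ii): if neither alternative holds, some `λ > 0` strictly separates `z` from `G`.)
[cite: ConnesConsani2016ArithmeticSite, Prop. 6.21 (proof of (ii)) and Prop. 6.19 (proof: "intersection of the half planes `H_{λ,α}`")] -/
theorem support_pair (G : Finset (ℤ × ℤ)) (z : ℤ × ℤ)
    (hz : ∀ l : ℝ, 0 < l → ∃ g ∈ G, l * g.1 + g.2 ≤ l * z.1 + z.2) :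
    (∃ g ∈ G, g ≤ z) ∨ ∃ x ∈ G, ∃ y ∈ G, x.1 ≤ z.1 ∧ y.2 ≤ z.2 ∧ z.2 < x.2 ∧ z.1 < y.1 ∧
      (y.1 - z.1) * (x.2 - z.2) ≤ (z.2 - y.2) * (z.1 - x.1) := by
  classical
  by_contra H
  push Not at H
  obtain ⟨H1, H2⟩ := H
  -- the generators left of `z` (strictly) and below `z`
  set A := G.filter (fun g => g.1 < z.1) with hA
  set B := G.filter (fun g => g.2 ≤ z.2) with hB
  have hAz : ∀ g ∈ A, z.2 < g.2 := fun g hg => by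
    obtain ⟨hgG, hg1⟩ := Finset.mem_filter.1 hg
    by_contra h
    exact H1 g hgG (Prod.le_def.2 ⟨hg1.le, not_lt.1 h⟩)
  have hBz : ∀ g ∈ B, z.1 < g.1 := fun g hg => by
    obtain ⟨hgG, hg2⟩ := Finset.mem_filter.1 hg
    by_contra h
    exact H1 g hgG (Prod.le_def.2 ⟨not_lt.1 h, hg2⟩)
  -- slopes
  let sA : ℤ × ℤ → ℝ := fun g => ((g.2 : ℝ) - z.2) / ((z.1 : ℝ) - g.1)
  let tB : ℤ × ℤ → ℝ := fun g => ((z.2 : ℝ) - g.2) / ((g.1 : ℝ) - z.1)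
  have hsA : ∀ g ∈ A, 0 < sA g := fun g hg => by
    have h1 := (Finset.mem_filter.1 hg).2
    have h2 := hAz g hg
    have h1' : (g.1 : ℝ) < z.1 := by exact_mod_cast h1
    have h2' : (z.2 : ℝ) < g.2 := by exact_mod_cast h2
    exact div_pos (by linarith) (by linarith)
  have htB : ∀ g ∈ B, 0 ≤ tB g := fun g hg => by
    have h1 := (Finset.mem_filter.1 hg).2
    have h2 := hBz g hg
    have h1' : (g.2 : ℝ) ≤ z.2 := by exact_mod_cast h1
    have h2' : (z.1 : ℝ) < g.1 := by exact_mod_cast h2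
    exact div_nonneg (by linarith) (by linarith)
  have hts : ∀ x ∈ A, ∀ y ∈ B, tB y < sA x := fun x hx y hy => by
    obtain ⟨hxG, hx1⟩ := Finset.mem_filter.1 hx
    obtain ⟨hyG, hy2⟩ := Finset.mem_filter.1 hy
    have hx2 := hAz x hx
    have hy1 := hBz y hy
    have key := H2 x hxG y hyG hx1.le hy2 hx2 hy1
    have hx1' : (x.1 : ℝ) < z.1 := by exact_mod_cast hx1
    have hy1' : (z.1 : ℝ) < y.1 := by exact_mod_cast hy1
    have key' : ((z.2 : ℝ) - y.2) * ((z.1 : ℝ) - x.1) < ((y.1 : ℝ) - z.1) * ((x.2 : ℝ) - z.2) := by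
      exact_mod_cast key
    show ((z.2 : ℝ) - y.2) / ((y.1 : ℝ) - z.1) < ((x.2 : ℝ) - z.2) / ((z.1 : ℝ) - x.1)
    rw [div_lt_div_iff₀ (by linarith) (by linarith)]
    linarith
  -- the separating slope
  let T : ℝ := if hBn : B.Nonempty then B.sup' hBn tB else 0
  have hT0 : 0 ≤ T := by
    show 0 ≤ (if hBn : B.Nonempty then B.sup' hBn tB else 0)
    split_ifs with hBn
    · obtain ⟨g, hg⟩ := hBn
      exact (htB g hg).trans (Finset.le_sup' tB hg)
    · exact le_rfl
  have hTB : ∀ g ∈ B, tB g ≤ T := fun g hg => by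
    show tB g ≤ (if hBn : B.Nonempty then B.sup' hBn tB else 0)
    rw [dif_pos ⟨g, hg⟩]
    exact Finset.le_sup' tB hg
  have hTA : ∀ x ∈ A, T < sA x := fun x hx => by
    show (if hBn : B.Nonempty then B.sup' hBn tB else 0) < sA x
    split_ifs with hBn
    · obtain ⟨y, hy, hyeq⟩ := Finset.exists_mem_eq_sup' hBn tB
      rw [hyeq]; exact hts x hx y hy
    · exact hsA x hx
  let lam : ℝ := if hAn : A.Nonempty then (T + A.inf' hAn sA) / 2 else T + 1
  have hlamT : T < lam := by
    show T < (if hAn : A.Nonempty then (T + A.inf' hAn sA) / 2 else T + 1)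
    split_ifs with hAn
    · obtain ⟨x, hx, hxeq⟩ := Finset.exists_mem_eq_inf' hAn sA
      have := hTA x hx; rw [← hxeq] at this; linarith
    · linarith
  have hlamA : ∀ x ∈ A, lam < sA x := fun x hx => by
    show (if hAn : A.Nonempty then (T + A.inf' hAn sA) / 2 else T + 1) < sA x
    rw [dif_pos ⟨x, hx⟩]
    have h1 : A.inf' ⟨x, hx⟩ sA ≤ sA x := Finset.inf'_le sA hx
    obtain ⟨x', hx', hxeq⟩ := Finset.exists_mem_eq_inf' ⟨x, hx⟩ sA
    have h2 := hTA x' hx'; rw [← hxeq] at h2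
    linarith
  have hlam0 : 0 < lam := lt_of_le_of_lt hT0 hlamT
  -- every generator lies strictly above the line of slope `-lam` through `z`
  obtain ⟨g, hgG, hg⟩ := hz lam hlam0
  have hcon : lam * z.1 + z.2 < lam * g.1 + g.2 := by
    rcases lt_trichotomy g.1 z.1 with h1 | h1 | h1
    · -- `g ∈ A`
      have hgA : g ∈ A := Finset.mem_filter.2 ⟨hgG, h1⟩
      have hs := hlamA g hgA
      have h1' : (g.1 : ℝ) < z.1 := by exact_mod_cast h1
      have hs' : lam * ((z.1 : ℝ) - g.1) < (g.2 : ℝ) - z.2 := by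
        have := (lt_div_iff₀ (show (0 : ℝ) < (z.1 : ℝ) - g.1 by linarith)).1 hs
        linarith
      linarith
    · have h2 : z.2 < g.2 := by
        by_contra h; exact H1 g hgG (Prod.le_def.2 ⟨h1.le, not_lt.1 h⟩)
      have h1' : (g.1 : ℝ) = z.1 := by exact_mod_cast h1
      have h2' : (z.2 : ℝ) < g.2 := by exact_mod_cast h2
      rw [h1']; linarith
    · have h1' : (z.1 : ℝ) < g.1 := by exact_mod_cast h1
      by_cases h2 : g.2 ≤ z.2
      · have hgB : g ∈ B := Finset.mem_filter.2 ⟨hgG, h2⟩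
        have ht := lt_of_le_of_lt (hTB g hgB) hlamT
        have ht' : (z.2 : ℝ) - g.2 < lam * ((g.1 : ℝ) - z.1) := by
          have := (div_lt_iff₀ (show (0 : ℝ) < (g.1 : ℝ) - z.1 by linarith)).1 ht
          linarith
        linarith
      · have h2' : (z.2 : ℝ) < g.2 := by exact_mod_cast (not_le.1 h2)
        nlinarith
  exact absurd hg (not_le.2 hcon)

/-! ## Prop. 6.21 (ii): `γ(a) = γ(a') ⟺ ∃ c ≠ 0, ca = ca'` -/

/-- The factor `σ(y₁ - x₁, x₂ - y₂)` attached to a pair of generators `x, y`.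
[cite: ConnesConsani2016ArithmeticSite, Prop. 6.21 (proof of (ii): `σ(a_{i+1} - a_i, b_i - b_{i+1})`)] -/
def pairSigma (x y : ℤ × ℤ) : SubZ2 := sigmaElt (y.1 - x.1).toNat (x.2 - y.2).toNat

/-- The pairs of canonical generators `x, y` of `E` with `x₁ < y₁`, `y₂ < x₂`.
[cite: ConnesConsani2016ArithmeticSite, Prop. 6.21 (proof of (ii))] -/
def genPairs (E : SubZ2) : Finset ((ℤ × ℤ) × (ℤ × ℤ)) :=
  (E.minGens ×ˢ E.minGens).filter fun p => p.1.1 < p.2.1 ∧ p.2.2 < p.1.2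

/-- **The cancelling element `c`** attached to `E`: the product of the `σ`'s over all pairs of
canonical generators (the printed `c := ∏ σ(a_{i+1} - a_i, b_i - b_{i+1})` uses consecutive vertices
only; extra factors are harmless). [cite: ConnesConsani2016ArithmeticSite, Prop. 6.21 (proof of (ii))] -/
def cFactor (E : SubZ2) : SubZ2 := ∏ p ∈ genPairs E, pairSigma p.1 p.2

/-- `c ∈ ℕ̄ ⊗_𝔹 ℕ̄⁺`. [cite: ConnesConsani2016ArithmeticSite, Prop. 6.21 (proof of (ii))] -/
theorem cFactor_mem_subPlus (E : SubZ2) : cFactor E ∈ subPlus := by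
  refine Subsemiring.prod_mem _ fun p hp => ?_
  obtain ⟨-, h1, -⟩ := Finset.mem_filter.1 hp
  exact sigmaElt_mem_subPlus (by omega) _

/-- `Sub(ℤ × ℤ)` is non-trivial (`∅ ≠ I_0`). [cite: ConnesConsani2016ArithmeticSite, Lemma 6.4] -/
instance : Nontrivial SubZ2 :=
  ⟨⟨0, 1, fun h => by
    have h' := congrArg SubZ2.carrier h
    rw [zero_carrier, one_carrier] at h'
    exact (Set.mem_empty_iff_false (0 : ℤ × ℤ)).1 (h'.symm ▸ Set.self_mem_Ici)⟩⟩

/-- `c ≠ 0`. [cite: ConnesConsani2016ArithmeticSite, Prop. 6.21 (proof of (ii))] -/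
theorem cFactor_ne_zero (E : SubZ2) : cFactor E ≠ 0 := by
  refine Finset.prod_ne_zero_iff.2 fun p hp => ?_
  obtain ⟨-, h1, -⟩ := Finset.mem_filter.1 hp
  exact sigmaElt_ne_zero (by omega) _

/-- The region above the segment `[x, y]`: for `z` as in the support lemma,
`I_z ≤ I_{(x₁,y₂)} σ(y₁-x₁, x₂-y₂)`. [cite: ConnesConsani2016ArithmeticSite, Prop. 6.21 (proof of (ii): "`ℰ + Q ⊂ E ⊂ Conv(ℰ)`")] -/
theorem quad_le_quad_mul_pairSigma {x y z : ℤ × ℤ} (hx1 : x.1 ≤ z.1) (hy2 : y.2 ≤ z.2)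
    (hzx : z.2 < x.2) (hzy : z.1 < y.1) (hline : (y.1 - z.1) * (x.2 - z.2) ≤ (z.2 - y.2) * (z.1 - x.1)) :
    quad z ≤ quad (x.1, y.2) * pairSigma x y := by
  have ha : 0 < (y.1 - x.1).toNat := by omega
  rw [SubZ2.le_iff_subset, mul_carrier, quad_carrier, quad_carrier, pairSigma, sigmaElt_carrier ha]
  intro w hw
  obtain ⟨hw1, hw2⟩ := Prod.le_def.1 (Set.mem_Ici.1 hw)
  refine Set.mem_add.2 ⟨(x.1, y.2), Set.self_mem_Ici, (w.1 - x.1, w.2 - y.2),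
    ⟨by simp only; omega, by simp only; omega, ?_⟩, by ext <;> simp⟩
  have e1 : (((y.1 - x.1).toNat : ℕ) : ℤ) = y.1 - x.1 := Int.toNat_of_nonneg (by omega)
  have e2 : (((x.2 - y.2).toNat : ℕ) : ℤ) = x.2 - y.2 := Int.toNat_of_nonneg (by omega)
  rw [e1, e2]
  simp only
  nlinarith

/-- `I_x ⊕ I_y = I_{(x₁,y₂)} (q^{Δa} ⊗ 1 ⊕ 1 ⊗ q^{Δb})` for `x₁ < y₁`, `y₂ < x₂`.
[cite: ConnesConsani2016ArithmeticSite, Prop. 6.21 (proof of (ii): "`x = ∑ (q^{a_i} ⊗ q^{b_{i+1}})(q^{a_{i+1}-a_i} ⊗ 1 + 1 ⊗ q^{b_i - b_{i+1}})`")] -/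
theorem quad_add_quad_eq {x y : ℤ × ℤ} (hxy1 : x.1 < y.1) (hxy2 : y.2 < x.2) :
    quad x + quad y = quad (x.1, y.2) *
      (quad ((((y.1 - x.1).toNat : ℕ) : ℤ), 0) + quad (0, (((x.2 - y.2).toNat : ℕ) : ℤ))) := by
  rw [mul_add, quad_mul_quad, quad_mul_quad, Int.toNat_of_nonneg (by omega),
    Int.toNat_of_nonneg (by omega), add_comm (quad x)]
  congr 2
  · ext <;> simp
  · ext <;> simp

/-- **The absorption step**: if `z` lies on or above the lower envelopes of `E ≠ 0` for every slope,
then `c·I_z ≤ c·E` for `c = cFactor E`. [cite: ConnesConsani2016ArithmeticSite, Prop. 6.21 (proof of (ii))] -/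
theorem cFactor_mul_quad_le {E : SubZ2} (hE : E ≠ 0) {z : ℤ × ℤ}
    (hz : ∀ l : ℝ, 0 < l → frobExp l E hE ≤ l * z.1 + z.2) :
    cFactor E * quad z ≤ cFactor E * E := by
  classical
  have hz' : ∀ l : ℝ, 0 < l → ∃ g ∈ E.minGens, l * g.1 + g.2 ≤ l * z.1 + z.2 := fun l hl => by
    obtain ⟨g, hg, hgeq⟩ := Finset.exists_mem_eq_inf' (minGens_nonempty hE) fun x : ℤ × ℤ => l * x.1 + x.2
    exact ⟨g, hg, by have := hz l hl; unfold frobExp at this; rw [hgeq] at this; exact this⟩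
  rcases support_pair E.minGens z hz' with ⟨g, hg, hgz⟩ | ⟨x, hx, y, hy, hx1, hy2, hzx, hzy, hline⟩
  · exact SubZ2.mul_le_mul_left ((quad_le_iff.2 (E.isUpperSet hgz (mem_minGens.1 hg).prop))) _
  · -- the pair `(x, y)` contributes the factor `σ := pairSigma x y` to `c`
    have hp : (x, y) ∈ genPairs E :=
      Finset.mem_filter.2 ⟨Finset.mem_product.2 ⟨hx, hy⟩, by simp only; omega, by simp only; omega⟩
    obtain ⟨c', hc'⟩ : ∃ c', cFactor E = pairSigma x y * c' :=
      ⟨∏ p ∈ (genPairs E).erase (x, y), pairSigma p.1 p.2, (Finset.mul_prod_erase _ _ hp).symm⟩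
    have ha : 0 < (y.1 - x.1).toNat := by omega
    have hb : 0 < (x.2 - y.2).toNat := by omega
    -- `σ I_z ≤ σ I_{(x₁,y₂)} σ = I_{(x₁,y₂)} (I_x' ⊕ I_y') σ = (I_x ⊕ I_y) σ ≤ E σ`
    have h1 : pairSigma x y * quad z ≤ pairSigma x y * (quad (x.1, y.2) * pairSigma x y) :=
      SubZ2.mul_le_mul_left (quad_le_quad_mul_pairSigma hx1 hy2 hzx hzy hline) _
    have h2 : pairSigma x y * (quad (x.1, y.2) * pairSigma x y) = (quad x + quad y) * pairSigma x y := by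
      rw [quad_add_quad_eq (show x.1 < y.1 by omega) (show y.2 < x.2 by omega), mul_assoc, pairSigma,
        ConnesConsani2016_lemma_6_20_mul ha hb]
      ring
    have h3 : (quad x + quad y) * pairSigma x y ≤ E * pairSigma x y :=
      SubZ2.mul_le_mul_right (SubZ2.add_le (quad_le_of_mem_minGens hx) (quad_le_of_mem_minGens hy)) _
    rw [hc', mul_assoc, mul_assoc, mul_comm c', mul_comm c', ← mul_assoc, ← mul_assoc]
    refine SubZ2.mul_le_mul_right ?_ c'
    calc pairSigma x y * quad z ≤ pairSigma x y * (quad (x.1, y.2) * pairSigma x y) := h1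
      _ = (quad x + quad y) * pairSigma x y := h2
      _ ≤ E * pairSigma x y := h3
      _ = pairSigma x y * E := mul_comm _ _

/-- `γ(E) = 0 ↔ E = 0` ("the homomorphism `γ` fulfills `γ⁻¹({0}) = {0}`"). [cite: ConnesConsani2016ArithmeticSite, Prop. 6.21 (proof of (ii))] -/
theorem gammaHom_eq_zero_iff {E : SubZ2} : gammaHom E = 0 ↔ E = 0 := by
  constructor
  · intro h
    have h1 := congr_fun (congrArg Subtype.val h) ⟨1, one_pos⟩
    simp only [coe_gammaHom, envelope_apply, Subsemiring.coe_zero, Pi.zero_apply] at h1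
    exact (frobF_eq_zero_iff 1 _).1 h1
  · rintro rfl; exact map_zero _

/-- Equal images under `γ` have equal exponents `inf_E L_λ` for every `λ > 0`. [cite: ConnesConsani2016ArithmeticSite, Prop. 6.19] -/
theorem frobExp_eq_of_gammaHom_eq {E E' : SubZ2} (hE : E ≠ 0) (hE' : E' ≠ 0) (h : gammaHom E = gammaHom E')
    (l : ℝ) (hl : 0 < l) : frobExp l E hE = frobExp l E' hE' := by
  have := gammaHom_eq_iff.1 h l hl
  rwa [frobF_eq_texp l hl.le hE, frobF_eq_texp l hl.le hE', texp_inj] at this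

/-- If `γ(E) = γ(E')` then `c E' ≤ c E` for `c = cFactor E`. [cite: ConnesConsani2016ArithmeticSite, Prop. 6.21 (proof of (ii): "one gets `ac = a'c` as required")] -/
theorem cFactor_mul_le_of_gammaHom_eq {E E' : SubZ2} (hE : E ≠ 0) (hE' : E' ≠ 0)
    (h : gammaHom E = gammaHom E') : cFactor E * E' ≤ cFactor E * E := by
  conv_lhs => rw [eq_sum_minGens E', Finset.mul_sum]
  refine SubZ2.sum_le _ _ fun z hz => cFactor_mul_quad_le hE fun l hl => ?_
  rw [frobExp_eq_of_gammaHom_eq hE hE' h l hl]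
  exact Finset.inf'_le (fun x : ℤ × ℤ => l * x.1 + x.2) hz

/-- The cancelling element for a pair `E, E'` with `γ(E) = γ(E')`, inside `ℕ̄ ⊗_𝔹 ℕ̄⁺`.
[cite: ConnesConsani2016ArithmeticSite, Prop. 6.21 (proof of (ii))] -/
theorem exists_cancel_of_gammaHom_eq {E E' : SubZ2} (h : gammaHom E = gammaHom E') :
    ∃ c : SubZ2, c ∈ subPlus ∧ c ≠ 0 ∧ c * E = c * E' := by
  by_cases hE : E = 0
  · subst hE
    rw [map_zero, eq_comm, gammaHom_eq_zero_iff] at h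
    exact ⟨1, Subsemiring.one_mem _, one_ne_zero, by rw [h]⟩
  have hE' : E' ≠ 0 := fun h0 => hE (gammaHom_eq_zero_iff.1 (by rw [h, h0, map_zero]))
  refine ⟨cFactor E * cFactor E', Subsemiring.mul_mem _ (cFactor_mem_subPlus E) (cFactor_mem_subPlus E'),
    mul_ne_zero (cFactor_ne_zero E) (cFactor_ne_zero E'), le_antisymm ?_ ?_⟩
  · rw [mul_assoc, mul_assoc]
    exact SubZ2.mul_le_mul_left (cFactor_mul_le_of_gammaHom_eq hE' hE h.symm) _
  · rw [mul_comm (cFactor E), mul_assoc, mul_assoc]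
    exact SubZ2.mul_le_mul_left (cFactor_mul_le_of_gammaHom_eq hE hE' h) _

/-- **Connes–Consani 2016, Prop. 6.21 (ii)**: "The homomorphism `γ : ℕ̄ ⊗_𝔹 ℕ̄ → Conv(ℤ × ℤ)`
coincides with the homomorphism from `ℕ̄ ⊗_𝔹 ℕ̄` to its image in its semiring of quotients" — i.e.
"`∃ c ∈ ℕ̄ ⊗_𝔹 ℕ̄, c ≠ 0, ca = cb ⟹ γ(a) = γ(b)`" and conversely "for any `a, a'` one has
`γ(a) = γ(a') ⟹ ∃ c ≠ 0, ca = ca'`". (The converse is proved through the support lemma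
`support_pair` and Lemma 6.20 applied to all pairs of generators, instead of the extreme points
`ℰ = ∂Conv(E)`.) [cite: ConnesConsani2016ArithmeticSite, Prop. 6.21 (ii)] -/
theorem ConnesConsani2016_prop_6_21_ii (E E' : SubZ2) :
    gammaHom E = gammaHom E' ↔ ∃ c : SubZ2, c ≠ 0 ∧ c * E = c * E' := by
  constructor
  · intro h
    obtain ⟨c, -, hc, hcE⟩ := exists_cancel_of_gammaHom_eq h
    exact ⟨c, hc, hcE⟩
  · rintro ⟨c, hc, hcE⟩
    have h := congrArg gammaHom hcE
    rw [map_mul, map_mul] at h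
    exact mul_left_cancel₀ (fun h0 => hc (gammaHom_eq_zero_iff.1 h0)) h

/-! ## Prop. 6.21 (iii): the universal property of `γ : ℕ̄ ⊗_𝔹 ℕ̄ → Conv(ℤ × ℤ)` -/

section Universal621

variable {R : Type*} [Semiring R] [IsCancelMulZero R] (ρ : SubZ2 →+* R)
  (hρ : ∀ E, ρ E = 0 → E = 0)
include hρ

/-- A homomorphism with trivial kernel into a multiplicatively cancellative semiring is constant on
the fibres of `γ` ("Thus `ρ(a)` only depends upon `γ(a) ∈ Conv(ℤ × ℤ)`").
[cite: ConnesConsani2016ArithmeticSite, Prop. 6.21 (proof of (iii))] -/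
theorem eq_of_gammaHom_eq {E E' : SubZ2} (h : gammaHom E = gammaHom E') : ρ E = ρ E' := by
  obtain ⟨c, -, hc, hcE⟩ := exists_cancel_of_gammaHom_eq h
  have h' := congrArg ρ hcE
  rw [map_mul, map_mul] at h'
  exact mul_left_cancel₀ (fun h0 => hc (hρ c h0)) h'

/-- The factorisation `ρ' : Conv(ℤ × ℤ) → R` of `ρ` through `γ` (values on `γ(E)` are `ρ(E)`).
[cite: ConnesConsani2016ArithmeticSite, Prop. 6.21 (iii)] -/
def liftConv : ConvZ2 →+* R where
  toFun x := ρ (Classical.choose (gammaHom_surjective x))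
  map_zero' := by
    rw [← map_zero ρ]
    exact eq_of_gammaHom_eq ρ hρ ((Classical.choose_spec (gammaHom_surjective 0)).trans (map_zero _).symm)
  map_one' := by
    rw [← map_one ρ]
    exact eq_of_gammaHom_eq ρ hρ ((Classical.choose_spec (gammaHom_surjective 1)).trans (map_one _).symm)
  map_add' x y := by
    obtain ⟨E, rfl⟩ := gammaHom_surjective x
    obtain ⟨E', rfl⟩ := gammaHom_surjective y
    rw [← map_add ρ]
    refine eq_of_gammaHom_eq ρ hρ ?_
    rw [Classical.choose_spec (gammaHom_surjective (gammaHom E + gammaHom E')), map_add,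
      Classical.choose_spec (gammaHom_surjective (gammaHom E)), Classical.choose_spec (gammaHom_surjective (gammaHom E'))]
  map_mul' x y := by
    obtain ⟨E, rfl⟩ := gammaHom_surjective x
    obtain ⟨E', rfl⟩ := gammaHom_surjective y
    rw [← map_mul ρ]
    refine eq_of_gammaHom_eq ρ hρ ?_
    rw [Classical.choose_spec (gammaHom_surjective (gammaHom E * gammaHom E')), map_mul,
      Classical.choose_spec (gammaHom_surjective (gammaHom E)), Classical.choose_spec (gammaHom_surjective (gammaHom E'))]

/-- `ρ' ∘ γ = ρ`. [cite: ConnesConsani2016ArithmeticSite, Prop. 6.21 (iii)] -/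
theorem liftConv_gammaHom (E : SubZ2) : liftConv ρ hρ (gammaHom E) = ρ E :=
  eq_of_gammaHom_eq ρ hρ (Classical.choose_spec (gammaHom_surjective (gammaHom E)))

/-- **Connes–Consani 2016, Prop. 6.21 (iii)**: "Let `R` be a multiplicatively cancellative semiring
and `ρ : ℕ̄ ⊗_𝔹 ℕ̄ → R` a homomorphism such that `ρ⁻¹({0}) = {0}`. Then, there exists a unique semiring
homomorphism `ρ' : Conv(ℤ × ℤ) → R` such that `ρ = ρ' ∘ γ`."
[cite: ConnesConsani2016ArithmeticSite, Prop. 6.21 (iii)] -/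
theorem ConnesConsani2016_prop_6_21_iii : ∃! ρ' : ConvZ2 →+* R, ρ'.comp gammaHom = ρ := by
  refine ⟨liftConv ρ hρ, RingHom.ext fun E => liftConv_gammaHom ρ hρ E, fun ρ'' h => RingHom.ext fun x => ?_⟩
  obtain ⟨E, rfl⟩ := gammaHom_surjective x
  rw [liftConv_gammaHom, ← h, RingHom.comp_apply]

end Universal621

/-! ## Lemma 7.2: reduced correspondences factor through `γ : ℕ̄ ⊗_𝔹 ℕ̄⁺ → Conv(ℕ × ℕ)` -/

/-- **`Conv(ℕ × ℕ) = γ(ℕ̄ ⊗_𝔹 ℕ̄⁺)`**, the positive part of the reduced square's semiring.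
[cite: ConnesConsani2016ArithmeticSite, Lemma 7.2 (`ρ : Conv(ℕ × ℕ) → R`)] -/
def convPlus : Subsemiring ConvZ2 := subPlus.map gammaHom

/-- `γ` restricted: `ℕ̄ ⊗_𝔹 ℕ̄⁺ → Conv(ℕ × ℕ)`. [cite: ConnesConsani2016ArithmeticSite, Lemma 7.2] -/
def gammaPlus : subPlus →+* convPlus :=
  gammaHom.restrict subPlus convPlus fun x hx => Subsemiring.mem_map.2 ⟨x, hx, rfl⟩

/-- `γ⁺` is surjective. [cite: ConnesConsani2016ArithmeticSite, Lemma 7.2 (proof: "Since `γ` […] is surjective")] -/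
theorem gammaPlus_surjective : Function.Surjective gammaPlus := by
  rintro ⟨x, hx⟩
  obtain ⟨E, hE, rfl⟩ := Subsemiring.mem_map.1 hx
  exact ⟨⟨E, hE⟩, rfl⟩

/-- `γ⁺` on the underlying elements. [cite: ConnesConsani2016ArithmeticSite, Lemma 7.2] -/
@[simp] theorem coe_gammaPlus (E : subPlus) : ((gammaPlus E : convPlus) : ConvZ2) = gammaHom E := rfl

/-- `ι₁ : ℤ_min⁺ → ℕ̄ ⊗_𝔹 ℕ̄⁺`, `q^n ↦ q^n ⊗ 1`. [cite: ConnesConsani2016ArithmeticSite, §7.1 ("`ι_1(q^n) := q^n ⊗_𝔹 1`")] -/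
def iotaPlus₁ : ℕ̄ →+* subPlus :=
  (iota₁.comp plusHom).codRestrict subPlus fun x => by
    rcases eq_zero_or_eq_nexp x with rfl | ⟨n, rfl⟩
    · simp
    · rw [RingHom.comp_apply, plusHom_nexp, iota₁_zexp]
      exact quad_mem_subPlus (Prod.mk_le_mk.2 ⟨by positivity, le_rfl⟩)

/-- `ι₂ : ℤ_min⁺ → ℕ̄ ⊗_𝔹 ℕ̄⁺`, `q^n ↦ 1 ⊗ q^n`. [cite: ConnesConsani2016ArithmeticSite, §7.1 ("`ι_2(q^n) := 1 ⊗_𝔹 q^n`")] -/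
def iotaPlus₂ : ℕ̄ →+* subPlus :=
  (iota₂.comp plusHom).codRestrict subPlus fun x => by
    rcases eq_zero_or_eq_nexp x with rfl | ⟨n, rfl⟩
    · simp
    · rw [RingHom.comp_apply, plusHom_nexp, iota₂_zexp]
      exact quad_mem_subPlus (Prod.mk_le_mk.2 ⟨le_rfl, by positivity⟩)

/-- `ι₁⁺(q^n) = q^n ⊗ 1 = I_{(n,0)}`. [cite: ConnesConsani2016ArithmeticSite, §7.1] -/
@[simp] theorem coe_iotaPlus₁_nexp (n : ℕ) : ((iotaPlus₁ (nexp n) : subPlus) : SubZ2) = quad ((n : ℤ), 0) := by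
  show iota₁ (plusHom (nexp n)) = _
  rw [plusHom_nexp, iota₁_zexp]

/-- `ι₂⁺(q^n) = 1 ⊗ q^n = I_{(0,n)}`. [cite: ConnesConsani2016ArithmeticSite, §7.1] -/
@[simp] theorem coe_iotaPlus₂_nexp (n : ℕ) : ((iotaPlus₂ (nexp n) : subPlus) : SubZ2) = quad (0, (n : ℤ)) := by
  show iota₂ (plusHom (nexp n)) = _
  rw [plusHom_nexp, iota₂_zexp]

section Lemma72

variable (C : ReducedCorrespondence)

/-- The would-be values `ρ₀(q^a ⊗_𝔹 q^b) = ℓ(q^a) r(q^b)` (extended to `ℤ × ℤ` by clipping negatives,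
only non-negative exponents are used). [cite: ConnesConsani2016ArithmeticSite, Lemma 7.2 (proof: "`ρ₀(q^a ⊗_𝔹 q^b) = ℓ(q^a) r(q^b)`")] -/
def ellR (x : ℤ × ℤ) : C.R := C.ell (nexp x.1.toNat) * C.r (nexp x.2.toNat)

/-- The target of a reduced correspondence has characteristic one. [cite: ConnesConsani2016ArithmeticSite, Lemma 7.2 (proof: "a semiring of characteristic `1` is zero sum free")] -/
theorem ReducedCorrespondence.one_add_one : (1 : C.R) + 1 = 1 := by
  have h : (1 : ℕ̄) + 1 = 1 := by rw [← nexp_zero, nexp_add, min_self]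
  have := congrArg C.ell h
  rwa [map_add, map_one] at this

/-- `ℓ(q^a) r(q^b)` absorbs `ℓ(q^{a'}) r(q^{b'})` for `(a,b) ≤ (a',b')` (bilinearity, Lemma 6.2).
[cite: ConnesConsani2016ArithmeticSite, Lemma 7.2 (proof: Prop. 6.6 applied to `ℓ(q^a) r(q^b)`)] -/
theorem ellR_absorb {x y : ℤ × ℤ} (h : x ≤ y) : ellR C x + ellR C y = ellR C x := by
  have h1 : C.ell (nexp x.1.toNat) + C.ell (nexp y.1.toNat) = C.ell (nexp x.1.toNat) := by
    rw [← map_add, nexp_add, min_eq_left (Int.toNat_le_toNat h.1)]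
  have h2 : C.r (nexp x.2.toNat) + C.r (nexp y.2.toNat) = C.r (nexp x.2.toNat) := by
    rw [← map_add, nexp_add, min_eq_left (Int.toNat_le_toNat h.2)]
  set P := C.ell (nexp x.1.toNat)
  set P' := C.ell (nexp y.1.toNat)
  set Q := C.r (nexp x.2.toNat)
  set Q' := C.r (nexp y.2.toNat)
  have hR := add_self_of_one_add_one (ReducedCorrespondence.one_add_one C)
  have e : (P + P') * (Q + Q') + P' * Q' = (P + P') * (Q + Q') := by
    rw [show (P + P') * (Q + Q') = (P * Q + P * Q' + P' * Q) + P' * Q' by ring, add_assoc, hR]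
  show P * Q + P' * Q' = P * Q
  rw [h1, h2] at e
  exact e

/-- Multiplicativity of `ℓ(q^a) r(q^b)` on non-negative exponents. [cite: ConnesConsani2016ArithmeticSite, Lemma 7.2 (proof: "`ρ₀` is multiplicative")] -/
theorem ellR_add {x y : ℤ × ℤ} (hx : 0 ≤ x) (hy : 0 ≤ y) : ellR C (x + y) = ellR C x * ellR C y := by
  unfold ellR
  rw [Prod.fst_add, Prod.snd_add, Int.toNat_add hx.1 hy.1, Int.toNat_add hx.2 hy.2, ← nexp_mul, ← nexp_mul,
    map_mul, map_mul]
  ring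

/-- `ℓ(q^0) r(q^0) = 1`. [cite: ConnesConsani2016ArithmeticSite, Lemma 7.2] -/
theorem ellR_zero : ellR C 0 = 1 := by
  simp [ellR]

/-- Multiplicativity of the lift on `ℕ̄ ⊗_𝔹 ℕ̄⁺` (all canonical generators are `≥ 0`).
[cite: ConnesConsani2016ArithmeticSite, Lemma 7.2 (proof: "`ρ₀` is multiplicative and hence it defines a homomorphism of semirings")] -/
theorem lift_ellR_mul {E E' : SubZ2} (hE : E ∈ subPlus) (hE' : E' ∈ subPlus) :
    SubZ2.lift (ellR C) (E * E') = SubZ2.lift (ellR C) E * SubZ2.lift (ellR C) E' := by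
  classical
  have hR := add_self_of_one_add_one (ReducedCorrespondence.one_add_one C)
  have hf : ∀ x y : ℤ × ℤ, x ≤ y → ellR C x + ellR C y = ellR C x := fun x y h => ellR_absorb C h
  conv_lhs => rw [← gen_minGens E, ← gen_minGens E', gen_mul_gen, SubZ2.lift_gen (ellR C) hR hf,
    Finset.sum_image_idem hR, Finset.sum_product' (f := fun x y => ellR C (x + y))]
  unfold SubZ2.lift
  rw [Finset.sum_mul_sum]
  refine Finset.sum_congr rfl fun x hx => Finset.sum_congr rfl fun y hy => ?_
  exact ellR_add C (mem_subPlus_iff_minGens.1 hE x hx) (mem_subPlus_iff_minGens.1 hE' y hy)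

/-- **`ρ₀ : ℕ̄ ⊗_𝔹 ℕ̄⁺ → R`**: "By Proposition 6.6 there exists a unique `𝔹`-linear map
`ρ₀ : ℕ̄ ⊗_𝔹 ℕ̄⁺ → R` such that `ρ₀(q^a ⊗_𝔹 q^b) = ℓ(q^a) r(q^b)` `∀ a, b ∈ ℕ`. Moreover `ρ₀` is
multiplicative and hence it defines a homomorphism of semirings." [cite: ConnesConsani2016ArithmeticSite, Lemma 7.2 (proof)] -/
def rho0 : subPlus →+* C.R where
  toFun E := SubZ2.lift (ellR C) (E : SubZ2)
  map_zero' := SubZ2.lift_zero _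
  map_one' := by
    rw [Subsemiring.coe_one, ← quad_zero, SubZ2.lift_quad (ellR C)
      (add_self_of_one_add_one (ReducedCorrespondence.one_add_one C)) (fun x y h => ellR_absorb C h), ellR_zero]
  map_add' E E' := SubZ2.lift_add (ellR C) (add_self_of_one_add_one (ReducedCorrespondence.one_add_one C))
    (fun x y h => ellR_absorb C h) _ _
  map_mul' E E' := lift_ellR_mul C E.2 E'.2

/-- `ρ₀(q^a ⊗_𝔹 q^b) = ℓ(q^a) r(q^b)`. [cite: ConnesConsani2016ArithmeticSite, Lemma 7.2 (proof)] -/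
theorem rho0_quad {x : ℤ × ℤ} (hx : 0 ≤ x) : rho0 C ⟨quad x, quad_mem_subPlus hx⟩ = ellR C x :=
  SubZ2.lift_quad (ellR C) (add_self_of_one_add_one (ReducedCorrespondence.one_add_one C))
    (fun _ _ h => ellR_absorb C h) x

/-- Every element of `ℕ̄ ⊗_𝔹 ℕ̄⁺` is a finite sum of products `ι₁(q^a) ι₂(q^b)`.
[cite: ConnesConsani2016ArithmeticSite, §7.1 ("the semiring `ℕ̄ ⊗_𝔹 ℕ̄` is generated by the images `ι_j(ℤ_min⁺)`")] -/
theorem subPlus_eq_sum (E : subPlus) :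
    E = ∑ x ∈ (E : SubZ2).minGens, iotaPlus₁ (nexp x.1.toNat) * iotaPlus₂ (nexp x.2.toNat) := by
  apply Subtype.ext
  rw [AddSubmonoidClass.coe_finsetSum]
  conv_lhs => rw [eq_sum_minGens (E : SubZ2)]
  refine Finset.sum_congr rfl fun x hx => ?_
  have hx0 : 0 ≤ x := mem_subPlus_iff_minGens.1 E.2 x hx
  rw [Subsemiring.coe_mul, coe_iotaPlus₁_nexp, coe_iotaPlus₂_nexp, quad_mul_quad, Prod.mk_add_mk, add_zero,
    zero_add, Int.toNat_of_nonneg hx0.1, Int.toNat_of_nonneg hx0.2]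

variable [IsCancelMulZero C.R]

/-- `ℓ(q^a) r(q^b) ≠ 0` ("`R` […] has no zero divisors and `ℓ(q^a) r(q^b) ≠ 0` `∀ a, b ∈ ℕ`").
[cite: ConnesConsani2016ArithmeticSite, Lemma 7.2 (proof)] -/
theorem ellR_ne_zero (x : ℤ × ℤ) : ellR C x ≠ 0 := by
  have h1 : C.ell (nexp x.1.toNat) ≠ 0 := fun h => nexp_ne_zero _ ((C.ell_eq_zero_iff _).1 h)
  have h2 : C.r (nexp x.2.toNat) ≠ 0 := fun h => nexp_ne_zero _ ((C.r_eq_zero_iff _).1 h)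
  intro h
  unfold ellR at h
  rw [← mul_zero (C.ell (nexp x.1.toNat))] at h
  exact h2 (mul_left_cancel₀ h1 h)

/-- "`ρ₀⁻¹({0}) = {0}`" (zero sum freeness and `ℓ(q^a) r(q^b) ≠ 0`). [cite: ConnesConsani2016ArithmeticSite, Lemma 7.2 (proof, eq. (59))] -/
theorem rho0_eq_zero {E : subPlus} (h : rho0 C E = 0) : E = 0 := by
  classical
  have h1R := ReducedCorrespondence.one_add_one C
  apply Subtype.ext
  show (E : SubZ2) = 0
  rw [← minGens_eq_empty_iff]
  by_contra hne
  obtain ⟨m, hm⟩ := Finset.nonempty_iff_ne_empty.2 hne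
  have hsum : SubZ2.lift (ellR C) (E : SubZ2) = 0 := h
  unfold SubZ2.lift at hsum
  rw [← Finset.add_sum_erase _ _ hm] at hsum
  exact ellR_ne_zero C m (eq_zero_of_add_eq_zero_charOne h1R hsum)

/-- `ρ₀` is constant on the fibres of `γ⁺` (via Prop. 6.21 (ii) with `c ∈ ℕ̄ ⊗_𝔹 ℕ̄⁺`).
[cite: ConnesConsani2016ArithmeticSite, Lemma 7.2 (proof: "We now apply Proposition 6.21 (iii)")] -/
theorem rho0_eq_of_gammaPlus_eq {E E' : subPlus} (h : gammaPlus E = gammaPlus E') : rho0 C E = rho0 C E' := by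
  have h' : gammaHom (E : SubZ2) = gammaHom (E' : SubZ2) := congrArg Subtype.val h
  obtain ⟨c, hcP, hc, hcE⟩ := exists_cancel_of_gammaHom_eq h'
  have h1 : rho0 C (⟨c, hcP⟩ * E) = rho0 C (⟨c, hcP⟩ * E') := congrArg (rho0 C) (Subtype.ext hcE)
  rw [map_mul, map_mul] at h1
  refine mul_left_cancel₀ (fun h0 => hc ?_) h1
  exact congrArg Subtype.val (rho0_eq_zero C h0)

/-- The factorisation `ρ : Conv(ℕ × ℕ) → R` of `ρ₀` through `γ⁺`. [cite: ConnesConsani2016ArithmeticSite, Lemma 7.2] -/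
def rhoConv : convPlus →+* C.R where
  toFun x := rho0 C (Classical.choose (gammaPlus_surjective x))
  map_zero' := by
    rw [← map_zero (rho0 C)]
    exact rho0_eq_of_gammaPlus_eq C ((Classical.choose_spec (gammaPlus_surjective 0)).trans (map_zero _).symm)
  map_one' := by
    rw [← map_one (rho0 C)]
    exact rho0_eq_of_gammaPlus_eq C ((Classical.choose_spec (gammaPlus_surjective 1)).trans (map_one _).symm)
  map_add' x y := by
    obtain ⟨E, rfl⟩ := gammaPlus_surjective x
    obtain ⟨E', rfl⟩ := gammaPlus_surjective y
    rw [← map_add (rho0 C)]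
    refine rho0_eq_of_gammaPlus_eq C ?_
    rw [Classical.choose_spec (gammaPlus_surjective (gammaPlus E + gammaPlus E')), map_add,
      Classical.choose_spec (gammaPlus_surjective (gammaPlus E)), Classical.choose_spec (gammaPlus_surjective (gammaPlus E'))]
  map_mul' x y := by
    obtain ⟨E, rfl⟩ := gammaPlus_surjective x
    obtain ⟨E', rfl⟩ := gammaPlus_surjective y
    rw [← map_mul (rho0 C)]
    refine rho0_eq_of_gammaPlus_eq C ?_
    rw [Classical.choose_spec (gammaPlus_surjective (gammaPlus E * gammaPlus E')), map_mul,
      Classical.choose_spec (gammaPlus_surjective (gammaPlus E)), Classical.choose_spec (gammaPlus_surjective (gammaPlus E'))]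

/-- `ρ ∘ γ⁺ = ρ₀`. [cite: ConnesConsani2016ArithmeticSite, Lemma 7.2 (proof: "`ρ₀ = ρ ∘ γ`")] -/
theorem rhoConv_gammaPlus (E : subPlus) : rhoConv C (gammaPlus E) = rho0 C E :=
  rho0_eq_of_gammaPlus_eq C (Classical.choose_spec (gammaPlus_surjective (gammaPlus E)))

/-- `ρ(γ(ι₁(q^n))) = ℓ(q^n)`. [cite: ConnesConsani2016ArithmeticSite, Lemma 7.2 ("`ℓ = ρ ∘ γ ∘ ι₁`")] -/
theorem rhoConv_iota₁ (x : ℕ̄) : rhoConv C (gammaPlus (iotaPlus₁ x)) = C.ell x := by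
  rw [rhoConv_gammaPlus]
  rcases eq_zero_or_eq_nexp x with rfl | ⟨n, rfl⟩
  · rw [map_zero, map_zero, map_zero]
  · have e : iotaPlus₁ (nexp n) = ⟨quad ((n : ℤ), 0), quad_mem_subPlus (Prod.mk_le_mk.2 ⟨by positivity, le_rfl⟩)⟩ :=
      Subtype.ext (coe_iotaPlus₁_nexp n)
    rw [e, rho0_quad C (Prod.mk_le_mk.2 ⟨by positivity, le_rfl⟩)]
    simp [ellR]

/-- `ρ(γ(ι₂(q^n))) = r(q^n)`. [cite: ConnesConsani2016ArithmeticSite, Lemma 7.2 ("`r = ρ ∘ γ ∘ ι₂`")] -/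
theorem rhoConv_iota₂ (x : ℕ̄) : rhoConv C (gammaPlus (iotaPlus₂ x)) = C.r x := by
  rw [rhoConv_gammaPlus]
  rcases eq_zero_or_eq_nexp x with rfl | ⟨n, rfl⟩
  · rw [map_zero, map_zero, map_zero]
  · have e : iotaPlus₂ (nexp n) = ⟨quad (0, (n : ℤ)), quad_mem_subPlus (Prod.mk_le_mk.2 ⟨le_rfl, by positivity⟩)⟩ :=
      Subtype.ext (coe_iotaPlus₂_nexp n)
    rw [e, rho0_quad C (Prod.mk_le_mk.2 ⟨le_rfl, by positivity⟩)]
    simp [ellR]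

/-- **Connes–Consani 2016, Lemma 7.2**: "Let `(R, ℓ, r)` be a reduced correspondence over `𝒜`, then
there exists a unique semiring homomorphism `ρ : Conv(ℕ × ℕ) → R` such that `ℓ = ρ ∘ γ ∘ ι₁` and
`r = ρ ∘ γ ∘ ι₂`." (`R` multiplicatively cancellative, as the proof uses: "As `R` is [multiplicatively
cancellative] by hypothesis, it has no zero divisors"; cf. Def. 7.1.) Proof as printed: `ρ₀` from
Prop. 6.6, `ρ₀⁻¹({0}) = {0}` by zero-sum-freeness (59), then Prop. 6.21 (iii); uniqueness from the
surjectivity of `γ`. [cite: ConnesConsani2016ArithmeticSite, Lemma 7.2] -/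
theorem ConnesConsani2016_lemma_7_2 :
    ∃! ρ : convPlus →+* C.R,
      (∀ x, ρ (gammaPlus (iotaPlus₁ x)) = C.ell x) ∧ ∀ x, ρ (gammaPlus (iotaPlus₂ x)) = C.r x := by
  refine ⟨rhoConv C, ⟨rhoConv_iota₁ C, rhoConv_iota₂ C⟩, fun ρ' ⟨h1, h2⟩ => RingHom.ext fun x => ?_⟩
  obtain ⟨E, rfl⟩ := gammaPlus_surjective x
  rw [subPlus_eq_sum E]
  simp only [map_sum, map_mul, h1, h2, rhoConv_iota₁, rhoConv_iota₂]

end Lemma72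

end Literature.NumberTheory.ConnesConsani
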